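import Literature.MathematicalPhysics.QuantumFieldTheory.BalabanImbrieJaffe1984to88.BIJ88DeltaLoc234Torus
import Literature.MathematicalPhysics.QuantumFieldTheory.BalabanImbrieJaffe1984to88.BIJ88RandomWalk242

/-!
# `BalabanImbrieJaffe1984to88.BIJ88NeumannRandomWalkTorus` — T. Bałaban, *Regularity and decay of lattice Green's functions*, Commun.
Math. Phys. **89** (1983) 571–597 [Balaban1983RegularityDecay] (= [6] of [BalabanImbrieJaffe1988]), Sect. 2 p. 575–577 [PDF 5–7]:
**(2.2) `G₀`, (2.6) the locality of the Neumann operators, (2.9)–(2.11) the parametrix identity with the commutators `K_j` and the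
remainder `R`, (2.12) `G_k(Ω,A) = G₀(I − R)^{−1} = Σ_n G₀Rⁿ` and (2.13) the random walk representation — FOR THE NEUMANN PROPAGATORS
`G_k(Ω,u)` OF THE ABELIAN HIGGS MODEL ON THE TORUS OF RECORD** (my gen-15 `BIJ88NeumannPropagator227Torus.gBox`), with the letters
`h_iG_k(Q_i,u)h_i`, `K_i`, `K_iG_k(Q_i,u)h_i`, `G₀`, `R` and the walk terms as DEFINITIONS WITH BODIES and the identities PROVED; and
T. Bałaban, J. Imbrie, A. Jaffe, *Effective action and cluster properties of the abelian Higgs model*, Commun. Math. Phys. **114** (1988)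
257–315 [BalabanImbrieJaffe1988] p. 265 [PDF 9]: **the gauge covariance of every one of these operators** — *"by the difference of the
gauge transformation between the points of evaluation of the kernel"* — PROVED (the `G_k(Ω,u)` half of the sentence; the `C^{(k)}_Λ(u)`
half is the companion `BIJ88Claim265GaugeTransfTorus`).

statement-level skeleton of published theorems with citation tags; proofs where landed; nothing here is a claim about the Yang–Mills mass gap

PDFs held: `paper:balaban1983-cmp89-regularity-decay` p. 575–577 [PDF 5–7] (text layer, `lit read … --pages 5-8`, re-read this session);
`paper:balaban1988-cmp114-bij-abelian-higgs-effective-action` (journal page = PDF page + 256) p. 262–263 [PDF 6–7], p. 265 [PDF 9]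
(text layer re-read this session).

CITATION HEADER (lean-in-tree rule).  Part of the lit-balaban TYPED SKELETON (HOME `run/shared/lean/pub/lit-balaban/`), PHASE-2 proof
seat p31 gen 25 (unit `lit-balaban-p31-g25`; TAKING #2 line HOME/STATUS.md 2026-08-23T20:54:02Z, free-target protocol G.5-34(d)).
WHAT IS REPRODUCED: row **C2.Claim@265** of `HOME/lit-balaban-r18/ROWS-C2.md` (owner r18; head `proved` p253697 — p13's
`BIJ88WalkGaugeCovariance` for the abstract `ℤ^d` walk operators of [6] Sect. 5; the `C^{(k)}_Λ(u)` model instance = companion file) —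
THE `G_k(Ω,u)` HALF, as a model instance (member; cells only); the cell *"straightforward application of the random walk expansion of
[6]"* of rows **C2.Eq2.30/C2.Eq2.31** (p. 263; the EXPANSION ITSELF for the torus `G_k(Ω,u)` as objects — NOT the decay bounds, which
are p02's `BIJ88OpDecay230Proof` under kernel-decay hypotheses); and, as the «model instance on the BIJ torus Neumann propagators of
record», rows **B4.Eq2.2**, **B4.Eq2.10** ((2.10)–(2.11)), **B4.Eq2.12** ((2.12)–(2.13)) of `HOME/lit-balaban-r01/ROWS-B4.md` (owner r01;
heads proved on the `covOp` carrier of `B4GaugeCovariance` — `B4Commutators25to211.parametrix_identity`, `B4Eq26Locality`,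
`B4Eq213ConcreteWalk`; cells only).  Kind: definitions with bodies + theorems; NO `Prop`-valued fact introduced.

THE PRINTED TEXT (verbatim, [6] p. 575–577; p. 575–576 re-read from the page images `renders/original-p005-x2.png`, `-p006-x2.png` of
the held PDF, p. 577 from the text layer).  *"For each j ∈ ℤ^d, let us define the set □_j = Ω ∩ {a sum of large blocks for which the point
Mj is one of the vertices}. … Next let us define a partition of unity {h_j}_{j∈ℤ^d} on T_η. For each j ∈ ℤ^d, we take h_j(x) =
Π_{μ=1}^d h_{j_μ}(x_μ), and functions h_j(x), j ∈ ℤ, of one real variable x are defined as h_j(x) = h(x/M − j), h ∈ C_0^∞(]−⅔, ⅔[), h(x) = 1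
for x ∈ [−⅓, ⅓], and it is chosen in such a way that Σ_{j∈ℤ} h_j² = 1. Let us define an operator G₀ by the formula
G₀ = Σ_j h_jG_k(□_j, Ã_j)h_j, (2.2)"*; *"Special care has to be taken in considering boundary terms. Let us remark now that
(−Δ^{η,N}_{A,Ω})h_jG(□_j, Ã_j) = (−Δ^{η,N}_{Ã_j,□_j})h_jG(□_j, Ã), (2.6) because the function h_j can be ≠ 0 only on the part of the boundary
of □_j which is contained in the boundary of Ω."*; (2.9) *"(−Δ^η_A + m² + aP_k(A))G₀ = … = δ(x − x′) − Σ_j[…]"*; *"Let us define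
the operators (K_jφ)(x) = □_j(x)[Σ_{b∈st(x)}(∂^ηh_j)(b)(D^η_{Ã_j}φ)(b) + (Δ^ηh_j)(x)φ(x) − Σ_{x′∈B^k(y^k(x))} η^d(∂^ηh_j)(Γ^{(k)}_{x,y^k(x),x′})
U(Ã_j(Γ^{(k)}_{x,y^k(x),x′}))φ(x′)], (2.10)  R = Σ_j K_jG_k(□_j, Ã_j)h_j. (2.11)
In the sequel we will see that R is a small operator in reasonable norms because |∂^ηh_j| ≤ O(M^{−1}), |Δ^ηh_j| ≤ O(M^{−2}), so we have the
representations G_k(Ω, A) = G₀(I − R)^{−1} = Σ_{n=0}^∞ G₀Rⁿ. (2.12) They can be written in a very convenient form of "random walk"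
representation. … G_k(Ω, A) = Σ_ω h_{ω₀}G_k(□_{ω₀}, Ã_{ω₀})h_{ω₀}K_{ω₁}G_k(□_{ω₁}, Ã_{ω₁})h_{ω₁} … K_{ω_n}G_k(□_{ω_n}, Ã_{ω_n})h_{ω_n},
(2.13) and this representation follows from (2.12) and the obvious fact that G_k(□_j)h_jK_{j′}G_k(□_{j′}) = 0 if |j − j′| = max_μ|j_μ −
j′_μ| > 1."*  [BalabanImbrieJaffe1988] p. 262–263: *"In the scalar field sector, we have the η-lattice propagators G_k(Ω,u) defined on
subsets Ω ⊂ T_η with Neumann boundary conditions. … The boundary conditions are always at a distance O(r(e_k)) from x₁, x₂, so a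
straightforward application of the random walk expansion of [6] shows that (2.30), (2.31)"*; p. 265 l. 8–10 of the text layer: *"Note that
all operators introduced through random walk expansions of C^{(k)}_Λ(u) or G_k(Ω,u) transform properly under gauge transformations, that
is, by the difference of the gauge transformation between the points of evaluation of the kernel."*

THE TYPING (torus of record, level `j`, block level `k`, the standing range `j + k ≤ m + K`, `a = a_k > 0`, `c ≠ 0` as in gen 15).
* The operator of [6] (1.6) `−Δ^η_A + m² + aP_k(A)` restricted to `Ω` with Neumann boundary conditions IS, for the abelian Higgs model,
  gen 15's `nOp a c U k Ω = (χ_ΩD_u)ᴴ(χ_ΩD_u) + a(Q_k|_Ω)ᴴ(Q_k|_Ω)` (no mass: the `a_kQ_k^*Q_k` term is the regulator, [I] (4.6.2));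
  `N_Ω = nPad = nOp + 1_{Ωᶜ}` its padding (invertible for `Ω` a union of `k`-blocks, `isUnit_nPad`), `G_k(Ω,u) = gBox = N_Ω^{−1}1_Ω`.
* The real cut-offs `h_j` act as the diagonal operators `mulR h` (§1).  (2.6) on the torus (§2): `N_Ω·h = N_Q·h` — and `h·N_Ω = h·N_Q` —
  for EVERY `u`, whenever `Q ⊆ Ω` contains both ends of every bond of `Ω` touching `supp h`, every `k`-block of `Ω` meeting `supp h`, and
  `supp h ∩ Ω` (`nPad_mul_mulR_eq`; the printed reason *"h_j can be ≠ 0 only on the part of the boundary of □_j which is contained in the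
  boundary of Ω"*); packaged as a WINDOW `W ⊇` the bond-and-block neighbourhood of `supp h` with `Q = Ω ∩ W` (`IsWindow`,
  `nPad_mul_mulR_eq_of_window`).  [6]'s cubes `□_j = Ω ∩ {large blocks with vertex Mj}` are such windows∩Ω; the MODIFIED cube fields `Ã_j`
  of [6] p. 575 (equal to `A` near `supp h_j`) are not needed for the identities and not modelled — (2.27) of [BalabanImbrieJaffe1988] uses
  `u` itself in every `G_k(□_α,u)`.
* A LOCALIZATION DATUM (§3, `IsLocalization k Ω Q h`, purely combinatorial, gauge independent): finitely many labels `i`, regions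
  `Q_i ⊆ Ω` that are unions of `k`-blocks, real cut-offs `h_i` with the three clauses above and `Σ_i h_i(x)² = 1`.  The LETTERS (defs
  with bodies): `aLet i = h_iG_k(Q_i,u)h_i` ((2.2) summand), `kLet i = h_iH_{Q_i} − H_{Q_i}h_i` (the commutator `K_i`, (2.10) — its printed
  three-term form is r01's `B4Commutators25to211.fld_opK_mulVec` on the B4 carrier, not re-derived here), `bLet i = K_iG_k(Q_i,u)h_i`
  ((2.11) summand), `gZero = Σ_i aLet i` (2.2), `rOp = Σ_i bLet i` (2.11), `piece ω = aLet ω₀ · bLet ω₁ ⋯ bLet ω_n` ((2.13), p13's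
  `BIJ88RandomWalk242.Walk`/`walkTerm` shape over `B4RandomWalk213.bprod`).

WHAT IS PROVED (0 `sorry`, standard axioms; definitions with bodies `mulR`, `aLet`, `kLet`, `bLet`, `piece`, `gZero`, `rOp` and the
`Prop`-STRUCTURES WITH PARAMETERS `IsWindow k h W`, `IsLocalization k Ω Q h` (hypothesis packages, not facts)).
* §1 `mulR` algebra: `mulR_mul_apply`, `mul_mulR_apply`, `mulR_mul_mulR`, `mulR_one`, `mulR_zero`, `mulR_conjTranspose`, `mulR_comm_diagonal`,
  `sum_mulR_mul_mulR` (`Σ_i h_i² = 1 ⇒ Σ_i mulR h_i·mulR h_i = 1`), `proj_mul_mulR_comm`, `cproj_mul_mulR_comm`, `mulOp_mul_mulR`,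
  `mulOp_conjTranspose_mul_mulR`.
* §2 (2.3)/(2.6): `mulR_mulVec`, **`covD_mulR_mulVec`** ((2.3) `D_u(hφ)(b) = h(b₊)(D_uφ)(b) + c(h(b₊) − h(b₋))φ(b₋)`), `dN_mulVec_mulR`,
  `dMat_apply_eq_zero`, `chiN_conjTranspose_mul_chiN_of_subset`, **`gram_dN_of_subset`** (`(χ_ΩD)ᴴχ_QD = (χ_QD)ᴴχ_QD`, `Q ⊆ Ω`),
  **`gram_qMatK_of_subset`**, `dN_mul_mulR_eq`, `qMatK_mul_mulR_eq`, `cproj_mul_mulR_eq`, **`nPad_mul_mulR_eq`**, **`mulR_mul_nPad_eq`**,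
  `IsWindow.mem`, `isWindow_univ`, `isBlockUnion_inter`, **`nPad_mul_mulR_eq_of_window`**; support geometry of `H_Ω(u)`:
  **`nOp_apply_eq_zero_of_far`** (`H_Ω(u)(x,y) = 0` unless `x`, `y` are the ends of one bond or lie in one `k`-block), `mulR_nOp_mulR_eq_zero`.
* §3 (2.2), (2.9)–(2.12): `kLet_eq_nPad_comm`, **`kLet_apply`** (`K_i(x,y) = (h_i(x) − h_i(y))H_{Q_i}(x,y)`), `kLet_apply_eq_zero_of_eq`,
  `aLet_apply`, `bLet_apply_eq_zero`, `mulR_mul_kLet_eq_zero`, **`aLet_mul_bLet_eq_zero`**, **`bLet_mul_bLet_eq_zero`**,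
  **`letters_mul_eq_zero_of_far`** (the *"obvious fact"* `a_ib_l = 0 = b_ib_l` of p. 577 for labels whose cut-offs are disjoint and not
  coupled by `H_{Q_l}`, reduced to support geometry), `IsLocalization.of_windows`, `IsLocalization.single` (non-vacuity: one piece,
  `h ≡ 1`), `IsLocalization.of_partition` (every `Σ_i h_i² = 1` with `Q_i = Ω`: non-vacuity with `R ≠ 0`), `proj_mul_proj_of_subset`,
  `proj_mul_proj_of_subset'`, `cproj_mul_proj_of_subset`, `nPad_mul_gBox`, `gBox_mul_nPad`,
  `proj_mul_aLet`, `aLet_mul_proj`, `cproj_mul_aLet`, `proj_mul_kLet`, `mulR_sq_mul_proj`, **`nOp_mul_aLet`** (`H_Ω·h_iG_ih_i = h_i²1_Ω −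
  K_iG_ih_i`), **`nOp_mul_gZero`** (`H_Ω·G₀ = 1_Ω − R`, (2.9)/(2.11) literally), **`nPad_mul_gZero_add_cproj`** (`N_Ω(G₀ + 1_{Ωᶜ}) = 1 − R`),
  **`gBox_mul_one_sub_rOp`** (`G_k(Ω,u)(1 − R) = G₀`, NO smallness hypothesis), **`gBox_eq_gZero_mul_inv`** ((2.12) given
  `IsUnit (1 − R)`), `gZero_single`, `rOp_single`.
* §4 (2.12)/(2.13) as sums (norm scope `Matrix.Norms.Operator`): `piece_eq_walkTerm`, **`hasSum_gZero_mul_pow`** (`Σ_n G₀Rⁿ → G_k(Ω,u)`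
  given `‖R‖ < 1`, via `B4RandomWalk213.hasSum_of_norm_lt_one`), **`hasSum_piece`** (`G_k(Ω,u) = Σ_ω a_{ω₀}b_{ω₁}⋯b_{ω_n}`
  unconditionally, by p13's `BIJ88RandomWalk242.hasSum_walkTerm` under its letter bounds `‖a_i‖ ≤ α`, `‖b_i‖ ≤ β`, `Dβ < 1`, `‖R‖ < 1`).
* §5 p. 265, THE `G_k(Ω,u)` HALF: for `u ↦ u^g` (`gaugeAct g U`), `M_g = mulOp g`: **`kLet_gaugeAct`**, **`aLet_gaugeAct`**, **`bLet_gaugeAct`**,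
  `bprod_bLet_gaugeAct`, **`piece_gaugeAct`** (`T[u^g] = M_gT[u]M_gᴴ` for every walk term), entrywise **`piece_gaugeAct_apply`** /
  `piece_gaugeAct_apply'` (`T[u^g](x,y) = g(x)·T[u](x,y)·conj g(y) = (g(x)g(y)^{−1})·T[u](x,y)` — *"the difference of the gauge
  transformation between the points of evaluation of the kernel"*), `norm_piece_gaugeAct_apply`, `aLet_gaugeAct_apply`, `bLet_gaugeAct_apply`,
  `gZero_gaugeAct`, `rOp_gaugeAct`, `pow_rOp_gaugeAct`, `gZero_mul_pow_rOp_gaugeAct`, `gZero_mul_pow_rOp_gaugeAct_apply` (the partial sums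
  `G₀Rⁿ` of (2.12)).
* §6 norm bookkeeping (`ℓ^∞`-operator norm; private `row_sum_norm_le`): **`linfty_opNorm_sum_le_of_rows`** (the multiplicity bound `‖Σ_i B_i‖ ≤ m₀β`
  when every row is a zero row of all but `≤ m₀` of the `B_i`), `norm_mulR_le_one`, **`norm_aLet_le`** (`‖a_i‖ ≤ ‖G_k(Q_i,u)‖`),
  **`norm_bLet_le`** (`‖b_i‖ ≤ ‖K_iG_k(Q_i,u)‖`), `nOp_apply_eq_zero_of_not_mem`, `bLet_apply_eq_zero_of_not_mem`, **`norm_rOp_le`**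
  (`‖R‖ ≤ m₀β` when every site lies in `≤ m₀` of the `Q_i` — the volume-independent smallness of `R` from that of the letters), and
  **`hasSum_piece_of_inputs`** ((2.13) from the printed inputs: `|h_i| ≤ 1`, multiplicity `m₀`, adjacency degree `D`, `‖G_k(Q_i,u)‖ ≤ α`,
  `‖K_iG_k(Q_i,u)‖ ≤ β`, `m₀β < 1`, `Dβ < 1`).
HONEST SCOPE.  Algebra and combinatorics only: no bound on `K_i`, `R` or the letters (the analytic *"R is a small operator"*, Lemma 2.1
(2.15), Lemma 2.2, *"|∂^ηh_j| ≤ O(M^{−1})"*) — these enter (2.12)/(2.13) as the displayed hypotheses `‖R‖ < 1`, `‖a_i‖ ≤ α`, `‖b_i‖ ≤ β`,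
`Dβ < 1` (§6 reduces them to `‖G_k(Q_i,u)‖ ≤ α`, `‖K_iG_k(Q_i,u)‖ ≤ β`, `m₀β < 1`, `Dβ < 1`); the smooth `M`-cube partition of unity
of [6] p. 575 is NOT constructed here (the datum is abstract; the one-piece localization and `of_partition` witness non-vacuity; r01's `B4PartitionUnity22.hCube` is the `ℤ^d` construction on the B4 carrier); [6]'s `Ã_j` not modelled (see
above); the decay (2.30)/(2.31) is not touched.  Imports: gen 15 `BIJ88DeltaLoc234Torus` (→ `BIJ88NeumannPropagator227Torus`: `nOp`,
`nPad`, `gBox`, `mulOp`, gauge covariance) and p13's `BIJ88RandomWalk242` (→ `B4RandomWalk213`).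
v1.1 (same seat, same day; v1 = p372030 ACCEPTED 377f91dcbac4): verbatim p. 575–576 quotes re-read from the page images (the printed
(2.6) right-hand side reads `G(□_j, Ã)`; *"Σ_{j∈ℤ} h_j² = 1"*; the full (2.10) display); + (2.3) `covD_mulR_mulVec`/`dN_mulVec_mulR`,
`mulR_mulVec`; + the commutator kernel `kLet_apply` (`K_i(x,y) = (h_i(x) − h_i(y))H_{Q_i}(x,y)`), `kLet_apply_eq_zero_of_eq`, `aLet_apply`,
`bLet_apply_eq_zero`; + `IsLocalization.of_partition` (non-vacuity with `R ≠ 0`).  v1.2: + §6 (the norm bookkeeping: letter bounds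
from `|h_i| ≤ 1`, `‖R‖ ≤ m₀β` by row multiplicity, (2.13) from the printed inputs).  No statement of v1/v1.1 changed or removed.
Unit `lit-balaban-p31` (literature-prover-lit-balaban-p31-g25-0), 2026-08-23.  NOT summit progress.
-/

open scoped BigOperators Matrix ComplexConjugate
open Finset Matrix

namespace Literature.MathematicalPhysics.QuantumFieldTheory.BalabanImbrieJaffe1984to88.BIJ88NeumannRandomWalkTorus

open Literature.MathematicalPhysics.QuantumFieldTheory.Balaban1983to89
open BIJ88Sect3Statements (U1 toC cfg covD starB mem_starB toC_mul toC_inv norm_toC)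
open BIJ85BlockAveragesTorus BIJ85BlockAveragesTorusK
open BIJ88Vj5610Operator (dMat chiN)
open BIJ88NeumannNoZeroModesTorus BIJ88NeumannPropagator227Torus
open BIJ88DeltaLoc234Torus (mulOp mulOp_mul_conjTranspose conjTranspose_mul_mulOp mulOp_sandwich_apply nOp_gaugeAct gBox_gaugeAct)
open B4RandomWalk213 (bprod bprod_zero bprod_succ hasSum_of_norm_lt_one)
open BIJ88RandomWalk242 (Walk walkTerm hasSum_walkTerm)
open GaugeField (gaugeAct)

noncomputable section

variable {P : Params} {j : ℕ}

/-! ## §1 Real cut-offs as diagonal operators on `ℓ²(T^{(j)})` -/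

/-- The multiplication operator by a real function `h` on the sites of the torus (the `h_j` of [6] (2.2) as operators).
[cite: Balaban1983RegularityDecay, (2.2) p.575] -/
def mulR (h : Balaban1983to89.Site P j → ℝ) : Matrix (Balaban1983to89.Site P j) (Balaban1983to89.Site P j) ℂ :=
  diagonal fun x => (h x : ℂ)

/-- kernel: `(h·A)(x,y) = h(x)A(x,y)`. [cite: Balaban1983RegularityDecay, (2.2) p.575] -/
theorem mulR_mul_apply {n : Type*} (h : Balaban1983to89.Site P j → ℝ) (A : Matrix (Balaban1983to89.Site P j) n ℂ)
    (x : Balaban1983to89.Site P j) (y : n) : (mulR h * A) x y = (h x : ℂ) * A x y := by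
  unfold mulR; rw [diagonal_mul]

/-- kernel: `(A·h)(x,y) = A(x,y)h(y)`. [cite: Balaban1983RegularityDecay, (2.2) p.575] -/
theorem mul_mulR_apply {m : Type*} (A : Matrix m (Balaban1983to89.Site P j) ℂ) (h : Balaban1983to89.Site P j → ℝ) (x : m)
    (y : Balaban1983to89.Site P j) : (A * mulR h) x y = A x y * (h y : ℂ) := by
  unfold mulR; rw [mul_diagonal]

/-- kernel: `h·h′ = (hh′)` as operators. [cite: Balaban1983RegularityDecay, (2.2) p.575] -/
theorem mulR_mul_mulR (h h' : Balaban1983to89.Site P j → ℝ) : mulR h * mulR h' = mulR (fun x => h x * h' x) := by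
  unfold mulR; rw [diagonal_mul_diagonal]; congr 1; funext x; push_cast; rfl

/-- kernel: the cut-off `1` is the identity. [cite: Balaban1983RegularityDecay, (2.2) p.575] -/
theorem mulR_one : mulR (fun _ : Balaban1983to89.Site P j => (1 : ℝ)) = 1 := by
  unfold mulR; push_cast; exact diagonal_one

/-- kernel: the cut-off `0` is `0`. [cite: Balaban1983RegularityDecay, (2.2) p.575] -/
theorem mulR_zero : mulR (fun _ : Balaban1983to89.Site P j => (0 : ℝ)) = 0 := by
  unfold mulR; push_cast; exact diagonal_zero

/-- kernel: real cut-offs are Hermitian. [cite: Balaban1983RegularityDecay, (2.2) p.575] -/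
theorem mulR_conjTranspose (h : Balaban1983to89.Site P j → ℝ) : (mulR h)ᴴ = mulR h := by
  unfold mulR; rw [diagonal_conjTranspose]; congr 1; funext x; rw [Pi.star_apply, Complex.star_def, Complex.conj_ofReal]

/-- kernel: cut-offs commute with every diagonal operator. [cite: Balaban1983RegularityDecay, (2.2) p.575] -/
theorem mulR_comm_diagonal (h : Balaban1983to89.Site P j → ℝ) (d : Balaban1983to89.Site P j → ℂ) :
    mulR h * diagonal d = diagonal d * mulR h := by
  unfold mulR; rw [diagonal_mul_diagonal, diagonal_mul_diagonal]; congr 1; funext x; rw [mul_comm]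

/-- kernel: `Σ_i h_i(x)² = 1` ⇒ `Σ_i h_i·h_i = 1` as operators (the partition of unity of [6] p. 575).
[cite: Balaban1983RegularityDecay, (2.2) p.575] -/
theorem sum_mulR_mul_mulR {J : Type*} (s : Finset J) {h : J → Balaban1983to89.Site P j → ℝ} (hsum : ∀ x, ∑ i ∈ s, h i x ^ 2 = 1) :
    ∑ i ∈ s, mulR (h i) * mulR (h i) = 1 := by
  ext x y
  rw [Matrix.sum_apply]
  simp only [mulR_mul_mulR]
  unfold mulR
  by_cases hxy : x = y
  · subst hxy
    simp only [diagonal_apply_eq, Matrix.one_apply_eq]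
    have h1 := congrArg (fun r : ℝ => (r : ℂ)) (hsum x)
    push_cast at h1
    rw [← h1]
    exact Finset.sum_congr rfl fun i _ => by push_cast; ring
  · simp only [diagonal_apply_ne _ hxy, Finset.sum_const_zero, Matrix.one_apply_ne hxy]

/-- kernel: `1_X` commutes with every real cut-off. [cite: Balaban1983RegularityDecay, (2.2) p.575] -/
theorem proj_mul_mulR_comm (X : Finset (Balaban1983to89.Site P j)) (h : Balaban1983to89.Site P j → ℝ) : proj X * mulR h = mulR h * proj X := by
  unfold proj; rw [mulR_comm_diagonal]

/-- kernel: `1_{Xᶜ}` commutes with every real cut-off. [cite: Balaban1983RegularityDecay, (2.2) p.575] -/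
theorem cproj_mul_mulR_comm (X : Finset (Balaban1983to89.Site P j)) (h : Balaban1983to89.Site P j → ℝ) :
    cproj X * mulR h = mulR h * cproj X := by
  unfold cproj; rw [mulR_comm_diagonal]

/-- kernel: a gauge transformation `M_g` (gen 15's `mulOp`) commutes with every real cut-off. [cite: BalabanImbrieJaffe1988, p.265] -/
theorem mulOp_mul_mulR (g : GaugeTransf P j U1) (h : Balaban1983to89.Site P j → ℝ) : mulOp g * mulR h = mulR h * mulOp g := by
  unfold mulOp; rw [mulR_comm_diagonal]

/-- kernel: `M_gᴴ` commutes with every real cut-off. [cite: BalabanImbrieJaffe1988, p.265] -/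
theorem mulOp_conjTranspose_mul_mulR (g : GaugeTransf P j U1) (h : Balaban1983to89.Site P j → ℝ) :
    (mulOp g)ᴴ * mulR h = mulR h * (mulOp g)ᴴ := by
  unfold mulOp; rw [diagonal_conjTranspose, mulR_comm_diagonal]

/-! ## §2 (2.6): the Neumann operator of `Ω` agrees with that of `Q ⊆ Ω` against a cut-off supported away from `Ω ∖ Q` -/

section Locality

variable {k : ℕ} (a c : ℝ) (U : GaugeField P j U1)

/-- kernel: the covariant derivative matrix `D_u` couples a bond only to its two ends. [cite: BalabanImbrieJaffe1988, (5.6.9) p.287] -/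
theorem dMat_apply_eq_zero (c : ℝ) (u : PBond P j → ℂ) {b : PBond P j} {x : Balaban1983to89.Site P j} (h1 : x ≠ b.src) (h2 : x ≠ b.tgt) :
    dMat c u b x = 0 := by
  unfold dMat; rw [Matrix.of_apply, if_neg h2, if_neg h1, mul_zero, sub_self]

/-- kernel: `(h·φ)(x) = h(x)φ(x)`. [cite: Balaban1983RegularityDecay, (2.3) p.575] -/
theorem mulR_mulVec (h : Balaban1983to89.Site P j → ℝ) (φ : Balaban1983to89.Site P j → ℂ) (x : Balaban1983to89.Site P j) :
    (mulR h *ᵥ φ) x = (h x : ℂ) * φ x := by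
  unfold mulR; rw [mulVec_diagonal]

/-- **(2.3) ON THE TORUS** (the Leibniz rule of the covariant derivative against a real cut-off):
`(D_u(hφ))(b) = h(b₊)(D_uφ)(b) + c(h(b₊) − h(b₋))φ(b₋)` — with `c = η^{−1}`, `c(h(b₊) − h(b₋)) = (∂^ηh)(b)`; printed
*"(D^η_Ahφ)(b) = h(b₊)(D^η_Aφ)(b) + (∂^ηh)(b)φ(b₋), (2.3)"*. [cite: Balaban1983RegularityDecay, (2.3) p.575] -/
theorem covD_mulR_mulVec (c : ℝ) (u : PBond P j → ℂ) (h : Balaban1983to89.Site P j → ℝ) (φ : Balaban1983to89.Site P j → ℂ) (b : PBond P j) :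
    covD c u (mulR h *ᵥ φ) b = (h b.tgt : ℂ) * covD c u φ b + (c : ℂ) * ((h b.tgt : ℂ) - (h b.src : ℂ)) * φ b.src := by
  simp only [covD, mulR_mulVec]; ring

open Classical in
/-- **(2.3) for the Neumann-cut derivative `χ_ΩD_u`** (rows `b ⊂ Ω` only). [cite: Balaban1983RegularityDecay, (2.3) p.575] -/
theorem dN_mulVec_mulR (c : ℝ) (U : GaugeField P j U1) (Ω : Finset (Balaban1983to89.Site P j)) (h : Balaban1983to89.Site P j → ℝ)
    (φ : Balaban1983to89.Site P j → ℂ) (b : PBond P j) :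
    (dN c U Ω *ᵥ (mulR h *ᵥ φ)) b
      = if b ∈ starB Ω then (h b.tgt : ℂ) * covD c (cfg U) φ b + (c : ℂ) * ((h b.tgt : ℂ) - (h b.src : ℂ)) * φ b.src else 0 := by
  rw [dN_mulVec, covD_mulR_mulVec]

/-- kernel: `χ_Ωᴴχ_Q = χ_Q` for `Q ⊆ Ω` (the bonds of `Q` are bonds of `Ω`). [cite: Balaban1983RegularityDecay, (2.6) p.576] -/
theorem chiN_conjTranspose_mul_chiN_of_subset {Ω Q : Finset (Balaban1983to89.Site P j)} (hQΩ : Q ⊆ Ω) : (chiN Ω)ᴴ * chiN Q = chiN Q := by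
  unfold chiN
  rw [diagonal_conjTranspose, diagonal_mul_diagonal]
  congr 1; funext b
  rw [Pi.star_apply]
  by_cases hQ : b ∈ starB Q
  · have hΩ : b ∈ starB Ω := by rw [mem_starB] at hQ ⊢; exact ⟨hQΩ hQ.1, hQΩ hQ.2⟩
    simp [hQ, hΩ]
  · simp [hQ]

/-- kernel: **`(χ_ΩD_u)ᴴ(χ_QD_u) = (χ_QD_u)ᴴ(χ_QD_u)`** for `Q ⊆ Ω`. [cite: Balaban1983RegularityDecay, (2.6) p.576] -/
theorem gram_dN_of_subset {Ω Q : Finset (Balaban1983to89.Site P j)} (hQΩ : Q ⊆ Ω) :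
    (dN c U Ω)ᴴ * dN c U Q = (dN c U Q)ᴴ * dN c U Q := by
  unfold dN
  rw [conjTranspose_mul, conjTranspose_mul, Matrix.mul_assoc, Matrix.mul_assoc, ← Matrix.mul_assoc ((chiN Ω)ᴴ),
    ← Matrix.mul_assoc ((chiN Q)ᴴ), chiN_conjTranspose_mul_chiN_of_subset hQΩ, chiN_conjTranspose_mul_chiN_of_subset (subset_refl Q)]

/-- kernel: **`(Q_k|_Ω)ᴴ(Q_k|_Q) = (Q_k|_Q)ᴴ(Q_k|_Q)`** for `Q ⊆ Ω` (the blocks kept by `Q` are kept by `Ω`).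
[cite: Balaban1983RegularityDecay, (2.6) p.576] -/
theorem gram_qMatK_of_subset (k : ℕ) {Ω Q : Finset (Balaban1983to89.Site P j)} (hQΩ : Q ⊆ Ω) :
    (qMatK U k Ω)ᴴ * qMatK U k Q = (qMatK U k Q)ᴴ * qMatK U k Q := by
  ext x x'
  simp only [Matrix.mul_apply, conjTranspose_apply]
  refine Finset.sum_congr rfl fun y _ => ?_
  by_cases hQ : blockK k y ⊆ Q
  · have hΩ : blockK k y ⊆ Ω := hQ.trans hQΩ
    rw [qMatK_apply U k Ω y x, qMatK_apply U k Q y x]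
    simp only [hQ, hΩ, true_and]
  · rw [qMatK_apply U k Q y x']
    simp only [hQ, false_and, if_false, mul_zero]

/-- kernel: `χ_ΩD_u·h = χ_QD_u·h` when every bond of `Ω` touching `supp h` lies in `Q ⊆ Ω`. [cite: Balaban1983RegularityDecay, (2.6) p.576] -/
theorem dN_mul_mulR_eq {Ω Q : Finset (Balaban1983to89.Site P j)} {h : Balaban1983to89.Site P j → ℝ} (hQΩ : Q ⊆ Ω)
    (hb : ∀ b : PBond P j, (h b.src ≠ 0 ∨ h b.tgt ≠ 0) → b.src ∈ Ω → b.tgt ∈ Ω → b.src ∈ Q ∧ b.tgt ∈ Q) :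
    dN c U Ω * mulR h = dN c U Q * mulR h := by
  ext b x
  rw [mul_mulR_apply, mul_mulR_apply, dN_apply, dN_apply]
  by_cases hx : h x = 0
  · simp [hx]
  by_cases hd : dMat c (cfg U) b x = 0
  · simp [hd]
  have hxb : x = b.src ∨ x = b.tgt := by
    by_contra hcon
    exact hd (dMat_apply_eq_zero c (cfg U) (fun h1 => hcon (Or.inl h1)) (fun h2 => hcon (Or.inr h2)))
  have htouch : h b.src ≠ 0 ∨ h b.tgt ≠ 0 := by
    rcases hxb with rfl | rfl
    · exact Or.inl hx
    · exact Or.inr hx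
  have hiff : b ∈ starB Ω ↔ b ∈ starB Q := by
    rw [mem_starB, mem_starB]
    exact ⟨fun hΩ => hb b htouch hΩ.1 hΩ.2, fun hQ => ⟨hQΩ hQ.1, hQΩ hQ.2⟩⟩
  by_cases hΩ : b ∈ starB Ω
  · rw [if_pos hΩ, if_pos (hiff.1 hΩ)]
  · rw [if_neg hΩ, if_neg (fun hQ => hΩ (hiff.2 hQ))]

/-- kernel: `Q_k|_Ω·h = Q_k|_Q·h` when every `k`-block of `Ω` meeting `supp h` lies in `Q ⊆ Ω`. [cite: Balaban1983RegularityDecay, (2.6) p.576] -/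
theorem qMatK_mul_mulR_eq (k : ℕ) {Ω Q : Finset (Balaban1983to89.Site P j)} {h : Balaban1983to89.Site P j → ℝ} (hQΩ : Q ⊆ Ω)
    (hB : ∀ y : Balaban1983to89.Site P (j+k), (∃ x ∈ blockK k y, h x ≠ 0) → blockK k y ⊆ Ω → blockK k y ⊆ Q) :
    qMatK U k Ω * mulR h = qMatK U k Q * mulR h := by
  ext y x
  rw [mul_mulR_apply, mul_mulR_apply, qMatK_apply, qMatK_apply]
  by_cases hx : h x = 0
  · simp [hx]
  by_cases hxy : x ∈ blockK k y
  · by_cases hΩ : blockK k y ⊆ Ω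
    · have hQ : blockK k y ⊆ Q := hB y ⟨x, hxy, hx⟩ hΩ
      simp only [hΩ, hQ, hxy, and_self, if_true]
    · have hQ : ¬ blockK k y ⊆ Q := fun hQ => hΩ (hQ.trans hQΩ)
      simp only [hΩ, hQ, false_and, if_false]
  · simp only [hxy, and_false, if_false]

/-- kernel: `1_{Ωᶜ}·h = 1_{Qᶜ}·h` when `supp h ∩ Ω ⊆ Q ⊆ Ω`. [cite: Balaban1983RegularityDecay, (2.6) p.576] -/
theorem cproj_mul_mulR_eq {Ω Q : Finset (Balaban1983to89.Site P j)} {h : Balaban1983to89.Site P j → ℝ} (hQΩ : Q ⊆ Ω)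
    (hx : ∀ x, h x ≠ 0 → x ∈ Ω → x ∈ Q) : cproj Ω * mulR h = cproj Q * mulR h := by
  unfold cproj mulR
  rw [diagonal_mul_diagonal, diagonal_mul_diagonal]
  congr 1; funext x
  by_cases h0 : h x = 0
  · simp [h0]
  by_cases hΩ : x ∈ Ω
  · rw [if_pos hΩ, if_pos (hx x h0 hΩ)]
  · rw [if_neg hΩ, if_neg (fun hQ => hΩ (hQΩ hQ))]

/-- **(2.6) ON THE TORUS**: `N_Ω(u)·h = N_Q(u)·h` — the (padded) Neumann operator of `Ω` and that of `Q ⊆ Ω` AGREE against the cut-off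
`h`, for EVERY `U(1)` field `u`, provided `Q` contains both ends of every bond of `Ω` touching `supp h`, every `k`-block of `Ω` meeting
`supp h`, and `supp h ∩ Ω` (*"because the function h_j can be ≠ 0 only on the part of the boundary of □_j which is contained in the
boundary of Ω"*). [cite: Balaban1983RegularityDecay, (2.6) p.576] -/
theorem nPad_mul_mulR_eq (k : ℕ) {Ω Q : Finset (Balaban1983to89.Site P j)} {h : Balaban1983to89.Site P j → ℝ} (hQΩ : Q ⊆ Ω)
    (hb : ∀ b : PBond P j, (h b.src ≠ 0 ∨ h b.tgt ≠ 0) → b.src ∈ Ω → b.tgt ∈ Ω → b.src ∈ Q ∧ b.tgt ∈ Q)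
    (hB : ∀ y : Balaban1983to89.Site P (j+k), (∃ x ∈ blockK k y, h x ≠ 0) → blockK k y ⊆ Ω → blockK k y ⊆ Q)
    (hx : ∀ x, h x ≠ 0 → x ∈ Ω → x ∈ Q) :
    nPad a c U k Ω * mulR h = nPad a c U k Q * mulR h := by
  have h1 : (dN c U Ω)ᴴ * dN c U Ω * mulR h = (dN c U Q)ᴴ * dN c U Q * mulR h := by
    rw [Matrix.mul_assoc, dN_mul_mulR_eq c U hQΩ hb, ← Matrix.mul_assoc, gram_dN_of_subset c U hQΩ]
  have h2 : (qMatK U k Ω)ᴴ * qMatK U k Ω * mulR h = (qMatK U k Q)ᴴ * qMatK U k Q * mulR h := by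
    rw [Matrix.mul_assoc, qMatK_mul_mulR_eq U k hQΩ hB, ← Matrix.mul_assoc, gram_qMatK_of_subset U k hQΩ]
  rw [nPad, nPad, nOp_eq, nOp_eq, Matrix.add_mul, Matrix.add_mul, Matrix.add_mul, Matrix.add_mul, Matrix.smul_mul,
    Matrix.smul_mul, h1, h2, cproj_mul_mulR_eq hQΩ hx]

/-- **(2.6), ADJOINT FORM**: `h·N_Ω(u) = h·N_Q(u)` under the same conditions (both operators are Hermitian).
[cite: Balaban1983RegularityDecay, (2.6) p.576] -/
theorem mulR_mul_nPad_eq (k : ℕ) {Ω Q : Finset (Balaban1983to89.Site P j)} {h : Balaban1983to89.Site P j → ℝ} (hQΩ : Q ⊆ Ω)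
    (hb : ∀ b : PBond P j, (h b.src ≠ 0 ∨ h b.tgt ≠ 0) → b.src ∈ Ω → b.tgt ∈ Ω → b.src ∈ Q ∧ b.tgt ∈ Q)
    (hB : ∀ y : Balaban1983to89.Site P (j+k), (∃ x ∈ blockK k y, h x ≠ 0) → blockK k y ⊆ Ω → blockK k y ⊆ Q)
    (hx : ∀ x, h x ≠ 0 → x ∈ Ω → x ∈ Q) :
    mulR h * nPad a c U k Ω = mulR h * nPad a c U k Q := by
  have h0 := congrArg conjTranspose (nPad_mul_mulR_eq a c U k hQΩ hb hB hx)
  rwa [conjTranspose_mul, conjTranspose_mul, mulR_conjTranspose, nPad_conjTranspose, nPad_conjTranspose] at h0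

/-- A WINDOW for the cut-off `h` at block level `k`: a site set containing both ends of every bond touching `supp h` and every `k`-block
meeting `supp h` ([6]: the `2M`-cube around `Mj` for `supp h_j ⊂ {|x − Mj| < ⅔M}`). [cite: Balaban1983RegularityDecay, (2.6) p.576] -/
structure IsWindow (k : ℕ) (h : Balaban1983to89.Site P j → ℝ) (W : Finset (Balaban1983to89.Site P j)) : Prop where
  /-- bonds with an end in `supp h` lie in `W` -/
  bond : ∀ b : PBond P j, (h b.src ≠ 0 ∨ h b.tgt ≠ 0) → b.src ∈ W ∧ b.tgt ∈ W
  /-- `k`-blocks meeting `supp h` lie in `W` -/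
  block : ∀ y : Balaban1983to89.Site P (j+k), (∃ x ∈ blockK k y, h x ≠ 0) → blockK k y ⊆ W

/-- kernel: a window contains `supp h`. [cite: Balaban1983RegularityDecay, (2.6) p.576] -/
theorem IsWindow.mem {h : Balaban1983to89.Site P j → ℝ} {W : Finset (Balaban1983to89.Site P j)} (hW : IsWindow k h W)
    {x : Balaban1983to89.Site P j} (hx : h x ≠ 0) : x ∈ W :=
  hW.block (blkIter k x) ⟨x, mem_blockK_blkIter k x, hx⟩ (mem_blockK_blkIter k x)

/-- kernel: the whole torus is a window for every cut-off (so `Q = Ω` is always admissible). [cite: Balaban1983RegularityDecay, (2.6) p.576] -/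
theorem isWindow_univ (k : ℕ) (h : Balaban1983to89.Site P j → ℝ) : IsWindow k h (Finset.univ : Finset (Balaban1983to89.Site P j)) :=
  ⟨fun _ _ => ⟨Finset.mem_univ _, Finset.mem_univ _⟩, fun _ _ => Finset.subset_univ _⟩

/-- kernel: an intersection of two unions of `k`-blocks is a union of `k`-blocks. [cite: BalabanImbrieJaffe1988, (2.27) p.263] -/
theorem isBlockUnion_inter {Ω W : Finset (Balaban1983to89.Site P j)} (hΩ : IsBlockUnion k Ω) (hW : IsBlockUnion k W) :
    IsBlockUnion k (Ω ∩ W) := fun x hx =>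
  Finset.subset_inter (hΩ x (Finset.mem_inter.1 hx).1) (hW x (Finset.mem_inter.1 hx).2)

/-- **(2.6) FOR `□ = Ω ∩ W`**, `W` a window of `h`: `N_Ω(u)·h = N_{Ω∩W}(u)·h` for every `u`. [cite: Balaban1983RegularityDecay, (2.6) p.576] -/
theorem nPad_mul_mulR_eq_of_window (k : ℕ) {Ω W : Finset (Balaban1983to89.Site P j)} {h : Balaban1983to89.Site P j → ℝ}
    (hW : IsWindow k h W) : nPad a c U k Ω * mulR h = nPad a c U k (Ω ∩ W) * mulR h :=
  nPad_mul_mulR_eq a c U k Finset.inter_subset_left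
    (fun b hb hs ht => ⟨Finset.mem_inter.2 ⟨hs, (hW.bond b hb).1⟩, Finset.mem_inter.2 ⟨ht, (hW.bond b hb).2⟩⟩)
    (fun y hy hΩ => Finset.subset_inter hΩ (hW.block y hy))
    (fun _ hx hΩ => Finset.mem_inter.2 ⟨hΩ, hW.mem hx⟩)

/-- **SUPPORT GEOMETRY OF `H_Ω(u)`**: `H_Ω(u)(x,y) = 0` unless `x`, `y` are the two ends of one bond or lie in one `k`-block (the
operator is a bond Laplacian plus the block term `aQ_k^*Q_k`). [cite: Balaban1983RegularityDecay, (2.13) p.577] -/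
theorem nOp_apply_eq_zero_of_far (k : ℕ) (Ω : Finset (Balaban1983to89.Site P j)) {x y : Balaban1983to89.Site P j}
    (hb : ∀ b : PBond P j, (x = b.src ∨ x = b.tgt) → ¬ (y = b.src ∨ y = b.tgt)) (hB : blkIter k x ≠ blkIter k y) :
    nOp a c U k Ω x y = 0 := by
  rw [nOp_eq, Matrix.add_apply, Matrix.smul_apply, Matrix.mul_apply, Matrix.mul_apply]
  have h1 : ∑ b, (dN c U Ω)ᴴ x b * dN c U Ω b y = 0 := by
    refine Finset.sum_eq_zero fun b _ => ?_
    rw [conjTranspose_apply, dN_apply, dN_apply]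
    by_cases hxb : x = b.src ∨ x = b.tgt
    · have hyb := hb b hxb
      rw [dMat_apply_eq_zero c (cfg U) (fun h1 => hyb (Or.inl h1)) (fun h2 => hyb (Or.inr h2))]
      split_ifs <;> simp
    · rw [dMat_apply_eq_zero c (cfg U) (fun h1 => hxb (Or.inl h1)) (fun h2 => hxb (Or.inr h2))]
      split_ifs <;> simp
  have h2 : ∑ y', (qMatK U k Ω)ᴴ x y' * qMatK U k Ω y' y = 0 := by
    refine Finset.sum_eq_zero fun y' _ => ?_
    rw [conjTranspose_apply, qMatK_apply, qMatK_apply]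
    by_cases hx : x ∈ blockK k y'
    · have hy : y ∉ blockK k y' := fun hy => hB ((mem_blockK.1 hx).trans (mem_blockK.1 hy).symm)
      simp [hy]
    · simp [hx]
  rw [h1, h2, smul_zero, add_zero]

/-- kernel: `h_i·H_Ω(u)·h_l = 0` when no point of `supp h_i` is coupled to a point of `supp h_l` by `H_Ω(u)`.
[cite: Balaban1983RegularityDecay, (2.13) p.577] -/
theorem mulR_nOp_mulR_eq_zero (k : ℕ) (Ω : Finset (Balaban1983to89.Site P j)) {hi hl : Balaban1983to89.Site P j → ℝ}
    (hfar : ∀ x y, hi x ≠ 0 → hl y ≠ 0 → nOp a c U k Ω x y = 0) : mulR hi * nOp a c U k Ω * mulR hl = 0 := by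
  ext x y
  rw [mul_mulR_apply, mulR_mul_apply, Matrix.zero_apply]
  by_cases hx : hi x = 0
  · simp [hx]
  by_cases hy : hl y = 0
  · simp [hy]
  rw [hfar x y hx hy, mul_zero, zero_mul]

end Locality

/-! ## §3 (2.2), (2.9)–(2.12): the letters with bodies and the parametrix identity for `G_k(Ω,u)` -/

section Letters

variable {J : Type*}

/-- **(2.2) summand** `a_i = h_iG_k(Q_i,u)h_i`. [cite: Balaban1983RegularityDecay, (2.2) p.575] -/
def aLet (a c : ℝ) (U : GaugeField P j U1) (k : ℕ) (Q : J → Finset (Balaban1983to89.Site P j)) (h : J → Balaban1983to89.Site P j → ℝ)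
    (i : J) : Matrix (Balaban1983to89.Site P j) (Balaban1983to89.Site P j) ℂ :=
  mulR (h i) * gBox a c U k (Q i) * mulR (h i)

/-- **(2.10) `K_i`** as the commutator `h_iH_{Q_i}(u) − H_{Q_i}(u)h_i` of the cut-off with the Neumann operator of `Q_i` (its printed
three-term form is (2.10)). [cite: Balaban1983RegularityDecay, (2.10) p.576] -/
def kLet (a c : ℝ) (U : GaugeField P j U1) (k : ℕ) (Q : J → Finset (Balaban1983to89.Site P j)) (h : J → Balaban1983to89.Site P j → ℝ)
    (i : J) : Matrix (Balaban1983to89.Site P j) (Balaban1983to89.Site P j) ℂ :=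
  mulR (h i) * nOp a c U k (Q i) - nOp a c U k (Q i) * mulR (h i)

/-- **(2.11) summand** `b_i = K_iG_k(Q_i,u)h_i`. [cite: Balaban1983RegularityDecay, (2.11) p.576] -/
def bLet (a c : ℝ) (U : GaugeField P j U1) (k : ℕ) (Q : J → Finset (Balaban1983to89.Site P j)) (h : J → Balaban1983to89.Site P j → ℝ)
    (i : J) : Matrix (Balaban1983to89.Site P j) (Balaban1983to89.Site P j) ℂ :=
  kLet a c U k Q h i * gBox a c U k (Q i) * mulR (h i)

/-- **(2.13) walk term** `a_{ω₀}b_{ω₁}⋯b_{ω_n}` of the walk `ω = (ω₀; ω₁, …, ω_n)` (p13's `Walk`; all tuples admitted, the non-nearest-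
neighbour ones carry `0` by `aLet_mul_bLet_eq_zero`/`bLet_mul_bLet_eq_zero`). [cite: Balaban1983RegularityDecay, (2.13) p.577] -/
def piece (a c : ℝ) (U : GaugeField P j U1) (k : ℕ) (Q : J → Finset (Balaban1983to89.Site P j)) (h : J → Balaban1983to89.Site P j → ℝ)
    (ω : Walk J) : Matrix (Balaban1983to89.Site P j) (Balaban1983to89.Site P j) ℂ :=
  aLet a c U k Q h ω.start * bprod (bLet a c U k Q h) ω.len ω.steps

variable {k : ℕ} {a c : ℝ} {Ω : Finset (Balaban1983to89.Site P j)} {Q : J → Finset (Balaban1983to89.Site P j)}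
  {h : J → Balaban1983to89.Site P j → ℝ}

/-- kernel: `K_i` is also the commutator with the PADDED operator (`1_{Q_iᶜ}` commutes with `h_i`). [cite: Balaban1983RegularityDecay, (2.10) p.576] -/
theorem kLet_eq_nPad_comm (a c : ℝ) (U : GaugeField P j U1) (k : ℕ) (Q : J → Finset (Balaban1983to89.Site P j))
    (h : J → Balaban1983to89.Site P j → ℝ) (i : J) :
    kLet a c U k Q h i = mulR (h i) * nPad a c U k (Q i) - nPad a c U k (Q i) * mulR (h i) := by
  unfold kLet nPad cproj
  rw [Matrix.mul_add, Matrix.add_mul, mulR_comm_diagonal]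
  abel

/-- kernel: **THE COMMUTATOR KERNEL `K_i(x,y) = (h_i(x) − h_i(y))·H_{Q_i}(u)(x,y)`** — so `K_i` lives where `h_i` VARIES across a
coupled pair (the `∂^ηh_j`, `Δ^ηh_j` and `h_j(x′) − h_j(x)` factors of the printed (2.10); r01's `fld_comm_mulVec` on the B4 carrier).
[cite: Balaban1983RegularityDecay, (2.10) p.576] -/
theorem kLet_apply (a c : ℝ) (U : GaugeField P j U1) (k : ℕ) (Q : J → Finset (Balaban1983to89.Site P j))
    (h : J → Balaban1983to89.Site P j → ℝ) (i : J) (x y : Balaban1983to89.Site P j) :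
    kLet a c U k Q h i x y = ((h i x : ℂ) - (h i y : ℂ)) * nOp a c U k (Q i) x y := by
  unfold kLet; rw [Matrix.sub_apply, mulR_mul_apply, mul_mulR_apply]; ring

/-- kernel: `K_i(x,y) = 0` wherever `h_i(x) = h_i(y)` (inside the plateau of `h_i` and outside its support).
[cite: Balaban1983RegularityDecay, (2.10) p.576] -/
theorem kLet_apply_eq_zero_of_eq (a c : ℝ) (U : GaugeField P j U1) (k : ℕ) (Q : J → Finset (Balaban1983to89.Site P j))
    (h : J → Balaban1983to89.Site P j → ℝ) (i : J) {x y : Balaban1983to89.Site P j} (hxy : h i x = h i y) :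
    kLet a c U k Q h i x y = 0 := by
  rw [kLet_apply, hxy, sub_self, zero_mul]

/-- kernel: `a_i(x,y) = h_i(x)G_k(Q_i,u)(x,y)h_i(y)` — the letter `a_i` lives on `supp h_i × supp h_i`. [cite: Balaban1983RegularityDecay, (2.2) p.575] -/
theorem aLet_apply (a c : ℝ) (U : GaugeField P j U1) (k : ℕ) (Q : J → Finset (Balaban1983to89.Site P j))
    (h : J → Balaban1983to89.Site P j → ℝ) (i : J) (x y : Balaban1983to89.Site P j) :
    aLet a c U k Q h i x y = (h i x : ℂ) * gBox a c U k (Q i) x y * (h i y : ℂ) := by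
  unfold aLet; rw [mul_mulR_apply, mulR_mul_apply]

/-- kernel: `b_i(x,y) = 0` unless `y ∈ supp h_i` (the trailing cut-off of `K_iG_k(Q_i,u)h_i`). [cite: Balaban1983RegularityDecay, (2.11) p.576] -/
theorem bLet_apply_eq_zero (a c : ℝ) (U : GaugeField P j U1) (k : ℕ) (Q : J → Finset (Balaban1983to89.Site P j))
    (h : J → Balaban1983to89.Site P j → ℝ) (i : J) {x y : Balaban1983to89.Site P j} (hy : h i y = 0) :
    bLet a c U k Q h i x y = 0 := by
  unfold bLet; rw [mul_mulR_apply, hy, Complex.ofReal_zero, mul_zero]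

/-- kernel: `h_i·K_l = 0` when `h_ih_l = 0` and `h_i·H_{Q_l}·h_l = 0`. [cite: Balaban1983RegularityDecay, (2.13) p.577] -/
theorem mulR_mul_kLet_eq_zero (U : GaugeField P j U1) {i l : J} (hhl : ∀ x, h i x * h l x = 0)
    (hsep : mulR (h i) * nOp a c U k (Q l) * mulR (h l) = 0) : mulR (h i) * kLet a c U k Q h l = 0 := by
  unfold kLet
  rw [Matrix.mul_sub, ← Matrix.mul_assoc, ← Matrix.mul_assoc, mulR_mul_mulR, hsep, sub_zero]
  rw [show (fun x => h i x * h l x) = fun _ => (0 : ℝ) from funext hhl, mulR_zero, Matrix.zero_mul]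

/-- **THE "OBVIOUS FACT" OF p. 577, first half: `a_ib_l = 0`** when the cut-offs `h_i`, `h_l` are disjoint and not coupled by `H_{Q_l}`
(*"G_k(□_j)h_jK_{j′}G_k(□_{j′}) = 0 if |j − j′| > 1"*). [cite: Balaban1983RegularityDecay, (2.13) p.577] -/
theorem aLet_mul_bLet_eq_zero (U : GaugeField P j U1) {i l : J} (hhl : ∀ x, h i x * h l x = 0)
    (hsep : mulR (h i) * nOp a c U k (Q l) * mulR (h l) = 0) : aLet a c U k Q h i * bLet a c U k Q h l = 0 := by
  unfold aLet bLet
  calc mulR (h i) * gBox a c U k (Q i) * mulR (h i) * (kLet a c U k Q h l * gBox a c U k (Q l) * mulR (h l))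
      = mulR (h i) * gBox a c U k (Q i) * (mulR (h i) * kLet a c U k Q h l) * gBox a c U k (Q l) * mulR (h l) := by
        simp only [Matrix.mul_assoc]
    _ = 0 := by rw [mulR_mul_kLet_eq_zero U hhl hsep, Matrix.mul_zero, Matrix.zero_mul, Matrix.zero_mul]

/-- **THE "OBVIOUS FACT" OF p. 577, second half: `b_ib_l = 0`** under the same condition. [cite: Balaban1983RegularityDecay, (2.13) p.577] -/
theorem bLet_mul_bLet_eq_zero (U : GaugeField P j U1) {i l : J} (hhl : ∀ x, h i x * h l x = 0)
    (hsep : mulR (h i) * nOp a c U k (Q l) * mulR (h l) = 0) : bLet a c U k Q h i * bLet a c U k Q h l = 0 := by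
  unfold bLet
  calc kLet a c U k Q h i * gBox a c U k (Q i) * mulR (h i) * (kLet a c U k Q h l * gBox a c U k (Q l) * mulR (h l))
      = kLet a c U k Q h i * gBox a c U k (Q i) * (mulR (h i) * kLet a c U k Q h l) * gBox a c U k (Q l) * mulR (h l) := by
        simp only [Matrix.mul_assoc]
    _ = 0 := by rw [mulR_mul_kLet_eq_zero U hhl hsep, Matrix.mul_zero, Matrix.zero_mul, Matrix.zero_mul]

/-- **THE "OBVIOUS FACT" FROM SUPPORT GEOMETRY**: if `supp h_i ∩ supp h_l = ∅` and no point of `supp h_i` is an end of a bond whose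
other end is in `supp h_l`, nor in a common `k`-block with a point of `supp h_l`, then `a_ib_l = 0 = b_ib_l` (for [6]'s `M`-cube partition:
the labels with `|i − l|_∞ > 1`). [cite: Balaban1983RegularityDecay, (2.13) p.577] -/
theorem letters_mul_eq_zero_of_far (U : GaugeField P j U1) {i l : J} (hdis : ∀ x, h i x ≠ 0 → h l x = 0)
    (hfar : ∀ x y, h i x ≠ 0 → h l y ≠ 0 →
      (∀ b : PBond P j, (x = b.src ∨ x = b.tgt) → ¬ (y = b.src ∨ y = b.tgt)) ∧ blkIter k x ≠ blkIter k y) :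
    aLet a c U k Q h i * bLet a c U k Q h l = 0 ∧ bLet a c U k Q h i * bLet a c U k Q h l = 0 := by
  have hhl : ∀ x, h i x * h l x = 0 := fun x => by
    by_cases hx : h i x = 0
    · rw [hx, zero_mul]
    · rw [hdis x hx, mul_zero]
  have hsep : mulR (h i) * nOp a c U k (Q l) * mulR (h l) = 0 :=
    mulR_nOp_mulR_eq_zero a c U k (Q l) fun x y hx hy => nOp_apply_eq_zero_of_far a c U k (Q l) (hfar x y hx hy).1 (hfar x y hx hy).2
  exact ⟨aLet_mul_bLet_eq_zero U hhl hsep, bLet_mul_bLet_eq_zero U hhl hsep⟩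

variable [Fintype J]

/-- **(2.2) `G₀ = Σ_i h_iG_k(Q_i,u)h_i`**. [cite: Balaban1983RegularityDecay, (2.2) p.575] -/
def gZero (a c : ℝ) (U : GaugeField P j U1) (k : ℕ) (Q : J → Finset (Balaban1983to89.Site P j)) (h : J → Balaban1983to89.Site P j → ℝ) :
    Matrix (Balaban1983to89.Site P j) (Balaban1983to89.Site P j) ℂ :=
  ∑ i, aLet a c U k Q h i

/-- **(2.11) `R = Σ_i K_iG_k(Q_i,u)h_i`**. [cite: Balaban1983RegularityDecay, (2.11) p.576] -/
def rOp (a c : ℝ) (U : GaugeField P j U1) (k : ℕ) (Q : J → Finset (Balaban1983to89.Site P j)) (h : J → Balaban1983to89.Site P j → ℝ) :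
    Matrix (Balaban1983to89.Site P j) (Balaban1983to89.Site P j) ℂ :=
  ∑ i, bLet a c U k Q h i

/-- A LOCALIZATION DATUM for `Ω` at block level `k` (purely combinatorial, gauge independent): regions `Q_i ⊆ Ω` that are unions of
`k`-blocks, cut-offs `h_i` such that `Q_i` contains every bond of `Ω` touching `supp h_i`, every `k`-block of `Ω` meeting `supp h_i` and
`supp h_i ∩ Ω` ((2.6)), and `Σ_i h_i² = 1` (the partition of unity of p. 575; [6]: `Q_i = □_i = Ω ∩ {large blocks with vertex Mi}`).
[cite: Balaban1983RegularityDecay, (2.2) p.575, (2.6) p.576] -/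
structure IsLocalization (k : ℕ) (Ω : Finset (Balaban1983to89.Site P j)) (Q : J → Finset (Balaban1983to89.Site P j))
    (h : J → Balaban1983to89.Site P j → ℝ) : Prop where
  /-- `Q_i ⊆ Ω` -/
  subset : ∀ i, Q i ⊆ Ω
  /-- `Q_i` is a union of `k`-blocks -/
  blockUnion : ∀ i, IsBlockUnion k (Q i)
  /-- bonds of `Ω` touching `supp h_i` lie in `Q_i` -/
  bond : ∀ i (b : PBond P j), (h i b.src ≠ 0 ∨ h i b.tgt ≠ 0) → b.src ∈ Ω → b.tgt ∈ Ω → b.src ∈ Q i ∧ b.tgt ∈ Q i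
  /-- `k`-blocks of `Ω` meeting `supp h_i` lie in `Q_i` -/
  block : ∀ i (y : Balaban1983to89.Site P (j+k)), (∃ x ∈ blockK k y, h i x ≠ 0) → blockK k y ⊆ Ω → blockK k y ⊆ Q i
  /-- `supp h_i ∩ Ω ⊆ Q_i` -/
  site : ∀ i x, h i x ≠ 0 → x ∈ Ω → x ∈ Q i
  /-- `Σ_i h_i(x)² = 1` -/
  sum_sq : ∀ x, ∑ i, h i x ^ 2 = 1

/-- **WINDOWS GIVE A LOCALIZATION**: `Q_i = Ω ∩ W_i` for windows `W_i` of `h_i` that are unions of `k`-blocks, `Ω` a union of `k`-blocks,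
`Σ_i h_i² = 1`. [cite: Balaban1983RegularityDecay, (2.6) p.576] -/
theorem IsLocalization.of_windows {k : ℕ} {Ω : Finset (Balaban1983to89.Site P j)} (hΩ : IsBlockUnion k Ω)
    {W : J → Finset (Balaban1983to89.Site P j)} {h : J → Balaban1983to89.Site P j → ℝ} (hW : ∀ i, IsWindow k (h i) (W i))
    (hWb : ∀ i, IsBlockUnion k (W i)) (hsum : ∀ x, ∑ i, h i x ^ 2 = 1) : IsLocalization k Ω (fun i => Ω ∩ W i) h where
  subset := fun _ => Finset.inter_subset_left
  blockUnion := fun i => isBlockUnion_inter hΩ (hWb i)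
  bond := fun i b hb hs ht => ⟨Finset.mem_inter.2 ⟨hs, ((hW i).bond b hb).1⟩, Finset.mem_inter.2 ⟨ht, ((hW i).bond b hb).2⟩⟩
  block := fun i y hy hΩ' => Finset.subset_inter hΩ' ((hW i).block y hy)
  site := fun i _ hx hΩ' => Finset.mem_inter.2 ⟨hΩ', (hW i).mem hx⟩
  sum_sq := hsum

/-- NON-VACUITY: the one-piece localization (`Q = Ω`, `h ≡ 1`). [cite: Balaban1983RegularityDecay, (2.2) p.575] -/
theorem IsLocalization.single {k : ℕ} {Ω : Finset (Balaban1983to89.Site P j)} (hΩ : IsBlockUnion k Ω) :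
    IsLocalization k Ω (fun _ : Unit => Ω) (fun _ _ => (1 : ℝ)) where
  subset := fun _ => subset_refl Ω
  blockUnion := fun _ => hΩ
  bond := fun _ _ _ hs ht => ⟨hs, ht⟩
  block := fun _ _ _ hB => hB
  site := fun _ _ _ hx => hx
  sum_sq := fun _ => by simp

/-- NON-VACUITY WITH `R ≠ 0`: EVERY partition of unity `Σ_i h_i² = 1` is a localization datum with `Q_i = Ω` (windows = the whole
torus, `isWindow_univ`) — the identities of this file then hold with the honest commutators `K_i = [h_i, H_Ω(u)]`.
[cite: Balaban1983RegularityDecay, (2.2) p.575] -/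
theorem IsLocalization.of_partition {k : ℕ} {Ω : Finset (Balaban1983to89.Site P j)} (hΩ : IsBlockUnion k Ω)
    {h : J → Balaban1983to89.Site P j → ℝ} (hsum : ∀ x, ∑ i, h i x ^ 2 = 1) : IsLocalization k Ω (fun _ : J => Ω) h where
  subset := fun _ => subset_refl Ω
  blockUnion := fun _ => hΩ
  bond := fun _ _ _ hs ht => ⟨hs, ht⟩
  block := fun _ _ _ hB => hB
  site := fun _ _ _ hx => hx
  sum_sq := hsum

/-- kernel: `1_Ω1_Q = 1_Q` for `Q ⊆ Ω`. [cite: BalabanImbrieJaffe1988, (2.27) p.263] -/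
theorem proj_mul_proj_of_subset {Q' : Finset (Balaban1983to89.Site P j)} (hQ : Q' ⊆ Ω) : proj Ω * proj Q' = proj Q' := by
  unfold proj; rw [diagonal_mul_diagonal]; congr 1; funext x
  by_cases hx : x ∈ Q'
  · rw [if_pos hx, if_pos (hQ hx), one_mul]
  · rw [if_neg hx, mul_zero]

/-- kernel: `1_{Ωᶜ}1_Q = 0` for `Q ⊆ Ω`. [cite: BalabanImbrieJaffe1988, (2.27) p.263] -/
theorem cproj_mul_proj_of_subset {Q' : Finset (Balaban1983to89.Site P j)} (hQ : Q' ⊆ Ω) : cproj Ω * proj Q' = 0 := by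
  unfold cproj proj; rw [diagonal_mul_diagonal, ← diagonal_zero]; congr 1; funext x
  by_cases hx : x ∈ Q'
  · rw [if_pos hx, if_pos (hQ hx), zero_mul]
  · rw [if_neg hx, mul_zero]

/-- kernel: `N_Q·G_k(Q,u) = 1_Q`. [cite: BalabanImbrieJaffe1988, (2.27) p.263] -/
theorem nPad_mul_gBox {U : GaugeField P j U1} {Q' : Finset (Balaban1983to89.Site P j)} (hN : IsUnit (nPad a c U k Q')) :
    nPad a c U k Q' * gBox a c U k Q' = proj Q' := by
  rw [gBox, ← Matrix.mul_assoc, mul_nonsing_inv _ ((isUnit_iff_isUnit_det _).1 hN), Matrix.one_mul]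

/-- kernel: `G_k(Q,u)·N_Q = 1_Q`. [cite: BalabanImbrieJaffe1988, (2.27) p.263] -/
theorem gBox_mul_nPad {U : GaugeField P j U1} {Q' : Finset (Balaban1983to89.Site P j)} (hN : IsUnit (nPad a c U k Q')) :
    gBox a c U k Q' * nPad a c U k Q' = proj Q' := by
  rw [gBox, Matrix.mul_assoc, proj_mul_nPad, ← nPad_mul_proj, ← Matrix.mul_assoc,
    nonsing_inv_mul _ ((isUnit_iff_isUnit_det _).1 hN), Matrix.one_mul]

/-- kernel: `1_Q1_Ω = 1_Q` for `Q ⊆ Ω`. [cite: BalabanImbrieJaffe1988, (2.27) p.263] -/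
theorem proj_mul_proj_of_subset' {Q' : Finset (Balaban1983to89.Site P j)} (hQ : Q' ⊆ Ω) : proj Q' * proj Ω = proj Q' := by
  unfold proj; rw [diagonal_mul_diagonal]; congr 1; funext x
  by_cases hx : x ∈ Q'
  · rw [if_pos hx, if_pos (hQ hx), one_mul]
  · rw [if_neg hx, zero_mul]

/-- kernel: `1_Ω·a_i = a_i` (the letters live on `Ω × Ω`). [cite: Balaban1983RegularityDecay, (2.2) p.575] -/
theorem proj_mul_aLet (D : IsLocalization k Ω Q h) (hk : j + k ≤ P.m + P.K) (hc : c ≠ 0) (ha : 0 < a) (U : GaugeField P j U1) (i : J) :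
    proj Ω * aLet a c U k Q h i = aLet a c U k Q h i := by
  have hN := isUnit_nPad hk hc ha U (D.blockUnion i)
  have hG : proj Ω * gBox a c U k (Q i) = gBox a c U k (Q i) := by
    rw [← proj_mul_gBox hN, ← Matrix.mul_assoc, proj_mul_proj_of_subset (D.subset i)]
  unfold aLet
  rw [← Matrix.mul_assoc, ← Matrix.mul_assoc, proj_mul_mulR_comm, Matrix.mul_assoc (mulR (h i)) (proj Ω), hG]

/-- kernel: `a_i·1_Ω = a_i`. [cite: Balaban1983RegularityDecay, (2.2) p.575] -/
theorem aLet_mul_proj (D : IsLocalization k Ω Q h) (U : GaugeField P j U1) (i : J) :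
    aLet a c U k Q h i * proj Ω = aLet a c U k Q h i := by
  have hG : gBox a c U k (Q i) * proj Ω = gBox a c U k (Q i) := by
    rw [← gBox_mul_proj (Ω := Q i), Matrix.mul_assoc, proj_mul_proj_of_subset' (D.subset i)]
  unfold aLet
  rw [Matrix.mul_assoc, ← proj_mul_mulR_comm, ← Matrix.mul_assoc, Matrix.mul_assoc (mulR (h i)) (gBox a c U k (Q i)), hG]

/-- kernel: `1_{Ωᶜ}·a_i = 0`. [cite: Balaban1983RegularityDecay, (2.2) p.575] -/
theorem cproj_mul_aLet (D : IsLocalization k Ω Q h) (hk : j + k ≤ P.m + P.K) (hc : c ≠ 0) (ha : 0 < a) (U : GaugeField P j U1) (i : J) :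
    cproj Ω * aLet a c U k Q h i = 0 := by
  have hN := isUnit_nPad hk hc ha U (D.blockUnion i)
  have hG : cproj Ω * gBox a c U k (Q i) = 0 := by
    rw [← proj_mul_gBox hN, ← Matrix.mul_assoc, cproj_mul_proj_of_subset (D.subset i), Matrix.zero_mul]
  unfold aLet
  rw [← Matrix.mul_assoc, ← Matrix.mul_assoc, cproj_mul_mulR_comm, Matrix.mul_assoc (mulR (h i)) (cproj Ω), hG, Matrix.mul_zero,
    Matrix.zero_mul]

/-- kernel: `1_Ω·K_i = K_i` (`K_i` lives on `Q_i × Q_i ⊆ Ω × Ω`). [cite: Balaban1983RegularityDecay, (2.10) p.576] -/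
theorem proj_mul_kLet (D : IsLocalization k Ω Q h) (U : GaugeField P j U1) (i : J) : proj Ω * kLet a c U k Q h i = kLet a c U k Q h i := by
  have h1 : proj Ω * nOp a c U k (Q i) = nOp a c U k (Q i) := by
    rw [← proj_mul_nOp a c U k (Q i), ← Matrix.mul_assoc, proj_mul_proj_of_subset (D.subset i)]
  unfold kLet
  rw [Matrix.mul_sub, ← Matrix.mul_assoc, ← Matrix.mul_assoc, proj_mul_mulR_comm, Matrix.mul_assoc (mulR (h i)), h1]

/-- kernel: `h_i²1_{Q_i} = h_i²1_Ω` (on `supp h_i`, membership in `Q_i` and in `Ω` agree). [cite: Balaban1983RegularityDecay, (2.9) p.576] -/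
theorem mulR_sq_mul_proj (D : IsLocalization k Ω Q h) (i : J) :
    mulR (h i) * mulR (h i) * proj (Q i) = mulR (h i) * mulR (h i) * proj Ω := by
  rw [mulR_mul_mulR]
  unfold mulR proj
  rw [diagonal_mul_diagonal, diagonal_mul_diagonal]
  congr 1; funext x
  by_cases h0 : h i x = 0
  · simp [h0]
  by_cases hΩ : x ∈ Ω
  · rw [if_pos hΩ, if_pos (D.site i x h0 hΩ)]
  · rw [if_neg hΩ, if_neg (fun hQ => hΩ (D.subset i hQ))]

/-- **(2.9) TERMWISE**: `H_Ω(u)·h_iG_k(Q_i,u)h_i = h_i²·1_Ω − K_iG_k(Q_i,u)h_i` (locality (2.6), `N_{Q_i}G_k(Q_i) = 1_{Q_i}`, and the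
commutator). [cite: Balaban1983RegularityDecay, (2.9) p.576] -/
theorem nOp_mul_aLet (D : IsLocalization k Ω Q h) (hk : j + k ≤ P.m + P.K) (hc : c ≠ 0) (ha : 0 < a) (U : GaugeField P j U1) (i : J) :
    nOp a c U k Ω * aLet a c U k Q h i = mulR (h i) * mulR (h i) * proj Ω - bLet a c U k Q h i := by
  have hN := isUnit_nPad hk hc ha U (D.blockUnion i)
  have hloc : nPad a c U k Ω * mulR (h i) = nPad a c U k (Q i) * mulR (h i) :=
    nPad_mul_mulR_eq a c U k (D.subset i) (D.bond i) (D.block i) (D.site i)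
  have hPG : nPad a c U k (Q i) * gBox a c U k (Q i) = proj (Q i) := nPad_mul_gBox hN
  have hPK : proj Ω * kLet a c U k Q h i = kLet a c U k Q h i := proj_mul_kLet D U i
  have hPP : proj Ω * proj (Q i) = proj (Q i) := proj_mul_proj_of_subset (D.subset i)
  have hsq : mulR (h i) * proj (Q i) * mulR (h i) = mulR (h i) * mulR (h i) * proj Ω := by
    rw [Matrix.mul_assoc, proj_mul_mulR_comm, ← Matrix.mul_assoc, mulR_sq_mul_proj D i]
  have hkey : nPad a c U k (Q i) * mulR (h i) * gBox a c U k (Q i)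
      = mulR (h i) * proj (Q i) - kLet a c U k Q h i * gBox a c U k (Q i) := by
    rw [kLet_eq_nPad_comm, Matrix.sub_mul, Matrix.mul_assoc (mulR (h i)), hPG]; abel
  calc nOp a c U k Ω * aLet a c U k Q h i
      = proj Ω * (nPad a c U k Ω * mulR (h i) * gBox a c U k (Q i)) * mulR (h i) := by
        rw [← proj_mul_nPad, aLet]; simp only [Matrix.mul_assoc]
    _ = proj Ω * (mulR (h i) * proj (Q i) - kLet a c U k Q h i * gBox a c U k (Q i)) * mulR (h i) := by rw [hloc, hkey]
    _ = mulR (h i) * mulR (h i) * proj Ω - bLet a c U k Q h i := by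
        rw [Matrix.mul_sub, Matrix.sub_mul, ← Matrix.mul_assoc (proj Ω) (mulR (h i)), proj_mul_mulR_comm,
          Matrix.mul_assoc (mulR (h i)) (proj Ω), hPP, hsq, ← Matrix.mul_assoc (proj Ω), hPK, bLet]

/-- **(2.9)/(2.11) `H_Ω(u)·G₀ = 1_Ω − R`** (*"= δ(x − x′) − Σ_j[…]"*, on `ℓ²(Ω)`), for EVERY `U(1)` field `u` and every localization datum.
[cite: Balaban1983RegularityDecay, (2.9)–(2.11) p.576] -/
theorem nOp_mul_gZero (D : IsLocalization k Ω Q h) (hk : j + k ≤ P.m + P.K) (hc : c ≠ 0) (ha : 0 < a) (U : GaugeField P j U1) :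
    nOp a c U k Ω * gZero a c U k Q h = proj Ω - rOp a c U k Q h := by
  unfold gZero rOp
  rw [Finset.mul_sum, Finset.sum_congr rfl fun i _ => nOp_mul_aLet D hk hc ha U i, Finset.sum_sub_distrib, ← Finset.sum_mul,
    sum_mulR_mul_mulR Finset.univ D.sum_sq, Matrix.one_mul]

/-- **THE PADDED PARAMETRIX IDENTITY `N_Ω(u)·(G₀ + 1_{Ωᶜ}) = 1 − R`** on all of `ℓ²(T^{(j)})` (r01's `parametrix_identity` shape `H·G₀ = 1 − R`).
[cite: Balaban1983RegularityDecay, (2.11) p.576] -/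
theorem nPad_mul_gZero_add_cproj (D : IsLocalization k Ω Q h) (hk : j + k ≤ P.m + P.K) (hc : c ≠ 0) (ha : 0 < a) (U : GaugeField P j U1) :
    nPad a c U k Ω * (gZero a c U k Q h + cproj Ω) = 1 - rOp a c U k Q h := by
  have h1 : cproj Ω * gZero a c U k Q h = 0 := by
    unfold gZero; rw [Finset.mul_sum]; exact Finset.sum_eq_zero fun i _ => cproj_mul_aLet D hk hc ha U i
  have h2 : nOp a c U k Ω * cproj Ω = 0 := by
    rw [← nOp_mul_proj, Matrix.mul_assoc, proj_mul_cproj, Matrix.mul_zero]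
  have h3 : cproj Ω * cproj Ω = cproj Ω := by
    unfold cproj; rw [diagonal_mul_diagonal]; congr 1; funext x; split_ifs <;> simp
  rw [Matrix.mul_add, nPad, Matrix.add_mul, Matrix.add_mul, nOp_mul_gZero D hk hc ha U, h1, h2, h3, add_zero, zero_add,
    sub_add_eq_add_sub, proj_add_cproj]

/-- **`G_k(Ω,u)·(1 − R) = G₀`** — the resolvent-free form of (2.12), with NO smallness hypothesis on `R` (every `u`, every localization
datum; the shape `G(1 − R) = G₀` consumed by p13's `hasSum_walkTerm`). [cite: Balaban1983RegularityDecay, (2.12) p.577] -/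
theorem gBox_mul_one_sub_rOp (D : IsLocalization k Ω Q h) (hk : j + k ≤ P.m + P.K) (hc : c ≠ 0) (ha : 0 < a) (U : GaugeField P j U1)
    (hΩ : IsBlockUnion k Ω) : gBox a c U k Ω * (1 - rOp a c U k Q h) = gZero a c U k Q h := by
  have hN := isUnit_nPad hk hc ha U hΩ
  have h1 : proj Ω * gZero a c U k Q h = gZero a c U k Q h := by
    unfold gZero; rw [Finset.mul_sum]; exact Finset.sum_congr rfl fun i _ => proj_mul_aLet D hk hc ha U i
  rw [← nPad_mul_gZero_add_cproj D hk hc ha U, ← Matrix.mul_assoc, gBox_mul_nPad hN, Matrix.mul_add, h1, proj_mul_cproj, add_zero]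

/-- **(2.12) `G_k(Ω,u) = G₀(I − R)^{−1}`**, given the invertibility of `1 − R`. [cite: Balaban1983RegularityDecay, (2.12) p.577] -/
theorem gBox_eq_gZero_mul_inv (D : IsLocalization k Ω Q h) (hk : j + k ≤ P.m + P.K) (hc : c ≠ 0) (ha : 0 < a) (U : GaugeField P j U1)
    (hΩ : IsBlockUnion k Ω) (hR : IsUnit (1 - rOp a c U k Q h)) : gBox a c U k Ω = gZero a c U k Q h * (1 - rOp a c U k Q h)⁻¹ := by
  rw [← gBox_mul_one_sub_rOp D hk hc ha U hΩ, Matrix.mul_assoc, mul_nonsing_inv _ ((isUnit_iff_isUnit_det _).1 hR), Matrix.mul_one]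

/-- kernel: the one-piece localization has `G₀ = G_k(Ω,u)`. [cite: Balaban1983RegularityDecay, (2.2) p.575] -/
theorem gZero_single (a c : ℝ) (U : GaugeField P j U1) (k : ℕ) (Ω : Finset (Balaban1983to89.Site P j)) :
    gZero a c U k (fun _ : Unit => Ω) (fun _ _ => (1 : ℝ)) = gBox a c U k Ω := by
  unfold gZero aLet; rw [Fintype.sum_unique, mulR_one, Matrix.one_mul, Matrix.mul_one]

/-- kernel: the one-piece localization has `R = 0` (`K = [1, H_Ω] = 0`). [cite: Balaban1983RegularityDecay, (2.11) p.576] -/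
theorem rOp_single (a c : ℝ) (U : GaugeField P j U1) (k : ℕ) (Ω : Finset (Balaban1983to89.Site P j)) :
    rOp a c U k (fun _ : Unit => Ω) (fun _ _ => (1 : ℝ)) = 0 := by
  unfold rOp bLet kLet; rw [Fintype.sum_unique, mulR_one]; simp only [Matrix.one_mul, Matrix.mul_one, sub_self, Matrix.zero_mul]

end Letters

/-! ## §4 (2.12) as a convergent series and (2.13) the random walk representation (norm: Mathlib scope `Matrix.Norms.Operator`) -/

section Walks

open scoped Matrix.Norms.Operator

variable {J : Type*} {k : ℕ} {a c : ℝ} {Ω : Finset (Balaban1983to89.Site P j)} {Q : J → Finset (Balaban1983to89.Site P j)}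
  {h : J → Balaban1983to89.Site P j → ℝ}

/-- kernel: the walk term IS p13's `walkTerm` of the letters `(a_i)`, `(b_i)`. [cite: BalabanImbrieJaffe1988, (2.42) p.264] -/
theorem piece_eq_walkTerm (a c : ℝ) (U : GaugeField P j U1) (k : ℕ) (Q : J → Finset (Balaban1983to89.Site P j))
    (h : J → Balaban1983to89.Site P j → ℝ) (ω : Walk J) : piece a c U k Q h ω = walkTerm (aLet a c U k Q h) (bLet a c U k Q h) ω := rfl

variable [Fintype J]

/-- **(2.12) `G_k(Ω,u) = Σ_{n≥0} G₀Rⁿ`** in the `ℓ^∞`-operator norm, GIVEN `‖R‖ < 1` (*"R is a small operator in reasonable norms"* — the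
analytic input, a hypothesis here). [cite: Balaban1983RegularityDecay, (2.12) p.577] -/
theorem hasSum_gZero_mul_pow (D : IsLocalization k Ω Q h) (hk : j + k ≤ P.m + P.K) (hc : c ≠ 0) (ha : 0 < a) (U : GaugeField P j U1)
    (hΩ : IsBlockUnion k Ω) (hR : ‖rOp a c U k Q h‖ < 1) :
    HasSum (fun n : ℕ => gZero a c U k Q h * rOp a c U k Q h ^ n) (gBox a c U k Ω) :=
  hasSum_of_norm_lt_one hR (gBox_mul_one_sub_rOp D hk hc ha U hΩ)

variable [DecidableEq J]

/-- **(2.13) THE RANDOM WALK REPRESENTATION OF `G_k(Ω,u)` ON THE TORUS**: `G_k(Ω,u) = Σ_ω a_{ω₀}b_{ω₁}⋯b_{ω_n}` as an UNCONDITIONAL sum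
over all walks (p13's `hasSum_walkTerm` *"as in [6]"*), for EVERY `U(1)` field `u` and every localization datum, GIVEN a label
adjacency off which the letters annihilate (`aLet_mul_bLet_eq_zero`/`bLet_mul_bLet_eq_zero`) with at most `D` neighbours per label, and the
analytic inputs `‖a_i‖ ≤ α`, `‖b_i‖ ≤ β`, `Dβ < 1`, `‖R‖ < 1`. [cite: Balaban1983RegularityDecay, (2.13) p.577] -/
theorem hasSum_piece (D : IsLocalization k Ω Q h) (hk : j + k ≤ P.m + P.K) (hc : c ≠ 0) (ha : 0 < a) (U : GaugeField P j U1)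
    (hΩ : IsBlockUnion k Ω) (adj : J → J → Prop) [DecidableRel adj] {α β : ℝ} {Dn : ℕ}
    (hab : ∀ i l, ¬ adj i l → aLet a c U k Q h i * bLet a c U k Q h l = 0)
    (hbb : ∀ i l, ¬ adj i l → bLet a c U k Q h i * bLet a c U k Q h l = 0)
    (hα : ∀ i, ‖aLet a c U k Q h i‖ ≤ α) (hβ : ∀ i, ‖bLet a c U k Q h i‖ ≤ β)
    (hD : ∀ l, (Finset.univ.filter fun i => adj l i).card ≤ Dn) (hDβ : (Dn : ℝ) * β < 1) (hR : ‖rOp a c U k Q h‖ < 1) :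
    HasSum (piece a c U k Q h) (gBox a c U k Ω) :=
  hasSum_walkTerm adj hab hbb hα hβ hD hDβ hR (gBox_mul_one_sub_rOp D hk hc ha U hΩ)

end Walks

/-! ## §5 [BalabanImbrieJaffe1988] p. 265: every operator of the expansion transforms by `g(x)(·)g(y)^{−1}` under `u ↦ u^g` -/

section Gauge

variable {J : Type*} {k : ℕ} {a c : ℝ} (Q : J → Finset (Balaban1983to89.Site P j)) (h : J → Balaban1983to89.Site P j → ℝ)
  (g : GaugeTransf P j U1) (U : GaugeField P j U1)

/-- **`K_i[u^g] = M_gK_i[u]M_gᴴ`**. [cite: BalabanImbrieJaffe1988, p.265] -/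
theorem kLet_gaugeAct (hk : j + k ≤ P.m + P.K) (a c : ℝ) (i : J) :
    kLet a c (gaugeAct g U) k Q h i = mulOp g * kLet a c U k Q h i * (mulOp g)ᴴ := by
  unfold kLet
  rw [nOp_gaugeAct hk, Matrix.mul_sub, Matrix.sub_mul]
  congr 1
  · calc mulR (h i) * (mulOp g * nOp a c U k (Q i) * (mulOp g)ᴴ) = mulR (h i) * mulOp g * nOp a c U k (Q i) * (mulOp g)ᴴ := by
          simp only [Matrix.mul_assoc]
      _ = mulOp g * (mulR (h i) * nOp a c U k (Q i)) * (mulOp g)ᴴ := by rw [← mulOp_mul_mulR]; simp only [Matrix.mul_assoc]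
  · calc mulOp g * nOp a c U k (Q i) * (mulOp g)ᴴ * mulR (h i) = mulOp g * nOp a c U k (Q i) * ((mulOp g)ᴴ * mulR (h i)) := by
          simp only [Matrix.mul_assoc]
      _ = mulOp g * (nOp a c U k (Q i) * mulR (h i)) * (mulOp g)ᴴ := by rw [mulOp_conjTranspose_mul_mulR]; simp only [Matrix.mul_assoc]

/-- **`a_i[u^g] = M_ga_i[u]M_gᴴ`** (`Q_i` a union of `k`-blocks; gen 15's `gBox_gaugeAct`). [cite: BalabanImbrieJaffe1988, p.265] -/
theorem aLet_gaugeAct (hk : j + k ≤ P.m + P.K) (hc : c ≠ 0) (ha : 0 < a) {i : J} (hQ : IsBlockUnion k (Q i)) :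
    aLet a c (gaugeAct g U) k Q h i = mulOp g * aLet a c U k Q h i * (mulOp g)ᴴ := by
  unfold aLet
  rw [gBox_gaugeAct hk hc ha g U hQ]
  calc mulR (h i) * (mulOp g * gBox a c U k (Q i) * (mulOp g)ᴴ) * mulR (h i)
      = mulR (h i) * mulOp g * gBox a c U k (Q i) * ((mulOp g)ᴴ * mulR (h i)) := by simp only [Matrix.mul_assoc]
    _ = mulOp g * mulR (h i) * gBox a c U k (Q i) * (mulR (h i) * (mulOp g)ᴴ) := by rw [← mulOp_mul_mulR, mulOp_conjTranspose_mul_mulR]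
    _ = mulOp g * (mulR (h i) * gBox a c U k (Q i) * mulR (h i)) * (mulOp g)ᴴ := by simp only [Matrix.mul_assoc]

/-- **`b_i[u^g] = M_gb_i[u]M_gᴴ`** (unitarity `M_gᴴM_g = 1`). [cite: BalabanImbrieJaffe1988, p.265] -/
theorem bLet_gaugeAct (hk : j + k ≤ P.m + P.K) (hc : c ≠ 0) (ha : 0 < a) {i : J} (hQ : IsBlockUnion k (Q i)) :
    bLet a c (gaugeAct g U) k Q h i = mulOp g * bLet a c U k Q h i * (mulOp g)ᴴ := by
  unfold bLet
  rw [kLet_gaugeAct Q h g U hk, gBox_gaugeAct hk hc ha g U hQ]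
  calc mulOp g * kLet a c U k Q h i * (mulOp g)ᴴ * (mulOp g * gBox a c U k (Q i) * (mulOp g)ᴴ) * mulR (h i)
      = mulOp g * kLet a c U k Q h i * ((mulOp g)ᴴ * mulOp g) * gBox a c U k (Q i) * ((mulOp g)ᴴ * mulR (h i)) := by
        simp only [Matrix.mul_assoc]
    _ = mulOp g * (kLet a c U k Q h i * gBox a c U k (Q i) * mulR (h i)) * (mulOp g)ᴴ := by
        rw [conjTranspose_mul_mulOp, Matrix.mul_one, mulOp_conjTranspose_mul_mulR]; simp only [Matrix.mul_assoc]

/-- kernel: the ordered products `b_{ω₁}⋯b_{ω_n}` conjugate too. [cite: BalabanImbrieJaffe1988, p.265] -/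
theorem bprod_bLet_gaugeAct (hk : j + k ≤ P.m + P.K) (hc : c ≠ 0) (ha : 0 < a) (hQ : ∀ i, IsBlockUnion k (Q i)) :
    ∀ (n : ℕ) (ys : Fin n → J),
      bprod (bLet a c (gaugeAct g U) k Q h) n ys = mulOp g * bprod (bLet a c U k Q h) n ys * (mulOp g)ᴴ
  | 0, ys => by rw [bprod_zero, bprod_zero, Matrix.mul_one, mulOp_mul_conjTranspose]
  | n + 1, ys => by
      rw [bprod_succ, bprod_succ, bprod_bLet_gaugeAct hk hc ha hQ n (Fin.tail ys), bLet_gaugeAct Q h g U hk hc ha (hQ (ys 0))]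
      calc mulOp g * bLet a c U k Q h (ys 0) * (mulOp g)ᴴ * (mulOp g * bprod (bLet a c U k Q h) n (Fin.tail ys) * (mulOp g)ᴴ)
          = mulOp g * bLet a c U k Q h (ys 0) * ((mulOp g)ᴴ * mulOp g) * bprod (bLet a c U k Q h) n (Fin.tail ys) * (mulOp g)ᴴ := by
            simp only [Matrix.mul_assoc]
        _ = mulOp g * (bLet a c U k Q h (ys 0) * bprod (bLet a c U k Q h) n (Fin.tail ys)) * (mulOp g)ᴴ := by
            rw [conjTranspose_mul_mulOp, Matrix.mul_one]; simp only [Matrix.mul_assoc]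

/-- **p. 265 FOR EVERY WALK TERM: `T_ω[u^g] = M_gT_ω[u]M_gᴴ`** (`T_ω = a_{ω₀}b_{ω₁}⋯b_{ω_n}`). [cite: BalabanImbrieJaffe1988, p.265] -/
theorem piece_gaugeAct (hk : j + k ≤ P.m + P.K) (hc : c ≠ 0) (ha : 0 < a) (hQ : ∀ i, IsBlockUnion k (Q i)) (ω : Walk J) :
    piece a c (gaugeAct g U) k Q h ω = mulOp g * piece a c U k Q h ω * (mulOp g)ᴴ := by
  unfold piece
  rw [aLet_gaugeAct Q h g U hk hc ha (hQ ω.start), bprod_bLet_gaugeAct Q h g U hk hc ha hQ ω.len ω.steps]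
  calc mulOp g * aLet a c U k Q h ω.start * (mulOp g)ᴴ * (mulOp g * bprod (bLet a c U k Q h) ω.len ω.steps * (mulOp g)ᴴ)
      = mulOp g * aLet a c U k Q h ω.start * ((mulOp g)ᴴ * mulOp g) * bprod (bLet a c U k Q h) ω.len ω.steps * (mulOp g)ᴴ := by
        simp only [Matrix.mul_assoc]
    _ = mulOp g * (aLet a c U k Q h ω.start * bprod (bLet a c U k Q h) ω.len ω.steps) * (mulOp g)ᴴ := by
        rw [conjTranspose_mul_mulOp, Matrix.mul_one]; simp only [Matrix.mul_assoc]

/-- **p. 265 ENTRYWISE: `T_ω[u^g](x,y) = g(x)·T_ω[u](x,y)·conj g(y)`**. [cite: BalabanImbrieJaffe1988, p.265] -/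
theorem piece_gaugeAct_apply (hk : j + k ≤ P.m + P.K) (hc : c ≠ 0) (ha : 0 < a) (hQ : ∀ i, IsBlockUnion k (Q i)) (ω : Walk J)
    (x y : Balaban1983to89.Site P j) :
    piece a c (gaugeAct g U) k Q h ω x y = toC (g x) * piece a c U k Q h ω x y * (starRingEnd ℂ) (toC (g y)) := by
  rw [piece_gaugeAct Q h g U hk hc ha hQ ω, mulOp_sandwich_apply]

/-- **p. 265, AS PRINTED: `T_ω[u^g](x,y) = (g(x)g(y)^{−1})·T_ω[u](x,y)`** — *"by the difference of the gauge transformation between the points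
of evaluation of the kernel"*. [cite: BalabanImbrieJaffe1988, p.265] -/
theorem piece_gaugeAct_apply' (hk : j + k ≤ P.m + P.K) (hc : c ≠ 0) (ha : 0 < a) (hQ : ∀ i, IsBlockUnion k (Q i)) (ω : Walk J)
    (x y : Balaban1983to89.Site P j) :
    piece a c (gaugeAct g U) k Q h ω x y = toC (g x * (g y)⁻¹) * piece a c U k Q h ω x y := by
  rw [piece_gaugeAct_apply Q h g U hk hc ha hQ ω x y, toC_mul, toC_inv]; ring

/-- kernel: the moduli of the walk-term entries are gauge invariant (`|g| = 1`). [cite: BalabanImbrieJaffe1988, p.265] -/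
theorem norm_piece_gaugeAct_apply (hk : j + k ≤ P.m + P.K) (hc : c ≠ 0) (ha : 0 < a) (hQ : ∀ i, IsBlockUnion k (Q i)) (ω : Walk J)
    (x y : Balaban1983to89.Site P j) : ‖piece a c (gaugeAct g U) k Q h ω x y‖ = ‖piece a c U k Q h ω x y‖ := by
  rw [piece_gaugeAct_apply' Q h g U hk hc ha hQ ω x y, norm_mul, norm_toC, one_mul]

/-- **p. 265 for the letter `a_i`, entrywise**. [cite: BalabanImbrieJaffe1988, p.265] -/
theorem aLet_gaugeAct_apply (hk : j + k ≤ P.m + P.K) (hc : c ≠ 0) (ha : 0 < a) {i : J} (hQ : IsBlockUnion k (Q i))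
    (x y : Balaban1983to89.Site P j) :
    aLet a c (gaugeAct g U) k Q h i x y = toC (g x * (g y)⁻¹) * aLet a c U k Q h i x y := by
  rw [aLet_gaugeAct Q h g U hk hc ha hQ, mulOp_sandwich_apply, toC_mul, toC_inv]; ring

/-- **p. 265 for the letter `b_i = K_iG_k(Q_i,u)h_i`, entrywise**. [cite: BalabanImbrieJaffe1988, p.265] -/
theorem bLet_gaugeAct_apply (hk : j + k ≤ P.m + P.K) (hc : c ≠ 0) (ha : 0 < a) {i : J} (hQ : IsBlockUnion k (Q i))
    (x y : Balaban1983to89.Site P j) :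
    bLet a c (gaugeAct g U) k Q h i x y = toC (g x * (g y)⁻¹) * bLet a c U k Q h i x y := by
  rw [bLet_gaugeAct Q h g U hk hc ha hQ, mulOp_sandwich_apply, toC_mul, toC_inv]; ring

variable [Fintype J]

/-- **`G₀[u^g] = M_gG₀[u]M_gᴴ`**. [cite: BalabanImbrieJaffe1988, p.265] -/
theorem gZero_gaugeAct (hk : j + k ≤ P.m + P.K) (hc : c ≠ 0) (ha : 0 < a) (hQ : ∀ i, IsBlockUnion k (Q i)) :
    gZero a c (gaugeAct g U) k Q h = mulOp g * gZero a c U k Q h * (mulOp g)ᴴ := by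
  unfold gZero
  rw [Finset.mul_sum, Finset.sum_mul]
  exact Finset.sum_congr rfl fun i _ => aLet_gaugeAct Q h g U hk hc ha (hQ i)

/-- **`R[u^g] = M_gR[u]M_gᴴ`**. [cite: BalabanImbrieJaffe1988, p.265] -/
theorem rOp_gaugeAct (hk : j + k ≤ P.m + P.K) (hc : c ≠ 0) (ha : 0 < a) (hQ : ∀ i, IsBlockUnion k (Q i)) :
    rOp a c (gaugeAct g U) k Q h = mulOp g * rOp a c U k Q h * (mulOp g)ᴴ := by
  unfold rOp
  rw [Finset.mul_sum, Finset.sum_mul]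
  exact Finset.sum_congr rfl fun i _ => bLet_gaugeAct Q h g U hk hc ha (hQ i)

/-- **`R[u^g]ⁿ = M_gR[u]ⁿM_gᴴ`**. [cite: BalabanImbrieJaffe1988, p.265] -/
theorem pow_rOp_gaugeAct (hk : j + k ≤ P.m + P.K) (hc : c ≠ 0) (ha : 0 < a) (hQ : ∀ i, IsBlockUnion k (Q i)) (n : ℕ) :
    rOp a c (gaugeAct g U) k Q h ^ n = mulOp g * rOp a c U k Q h ^ n * (mulOp g)ᴴ := by
  induction n with
  | zero => rw [pow_zero, pow_zero, Matrix.mul_one, mulOp_mul_conjTranspose]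
  | succ n ih =>
      rw [pow_succ, pow_succ, ih, rOp_gaugeAct Q h g U hk hc ha hQ]
      calc mulOp g * rOp a c U k Q h ^ n * (mulOp g)ᴴ * (mulOp g * rOp a c U k Q h * (mulOp g)ᴴ)
          = mulOp g * rOp a c U k Q h ^ n * ((mulOp g)ᴴ * mulOp g) * rOp a c U k Q h * (mulOp g)ᴴ := by simp only [Matrix.mul_assoc]
        _ = mulOp g * (rOp a c U k Q h ^ n * rOp a c U k Q h) * (mulOp g)ᴴ := by
            rw [conjTranspose_mul_mulOp, Matrix.mul_one]; simp only [Matrix.mul_assoc]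

/-- **`G₀[u^g]R[u^g]ⁿ = M_g(G₀[u]R[u]ⁿ)M_gᴴ`** — the partial sums of (2.12). [cite: BalabanImbrieJaffe1988, p.265] -/
theorem gZero_mul_pow_rOp_gaugeAct (hk : j + k ≤ P.m + P.K) (hc : c ≠ 0) (ha : 0 < a) (hQ : ∀ i, IsBlockUnion k (Q i)) (n : ℕ) :
    gZero a c (gaugeAct g U) k Q h * rOp a c (gaugeAct g U) k Q h ^ n = mulOp g * (gZero a c U k Q h * rOp a c U k Q h ^ n) * (mulOp g)ᴴ := by
  rw [gZero_gaugeAct Q h g U hk hc ha hQ, pow_rOp_gaugeAct Q h g U hk hc ha hQ n]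
  calc mulOp g * gZero a c U k Q h * (mulOp g)ᴴ * (mulOp g * rOp a c U k Q h ^ n * (mulOp g)ᴴ)
      = mulOp g * gZero a c U k Q h * ((mulOp g)ᴴ * mulOp g) * rOp a c U k Q h ^ n * (mulOp g)ᴴ := by simp only [Matrix.mul_assoc]
    _ = mulOp g * (gZero a c U k Q h * rOp a c U k Q h ^ n) * (mulOp g)ᴴ := by
        rw [conjTranspose_mul_mulOp, Matrix.mul_one]; simp only [Matrix.mul_assoc]

/-- **p. 265 for the partial sums `G₀Rⁿ` of (2.12), entrywise**. [cite: BalabanImbrieJaffe1988, p.265] -/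
theorem gZero_mul_pow_rOp_gaugeAct_apply (hk : j + k ≤ P.m + P.K) (hc : c ≠ 0) (ha : 0 < a) (hQ : ∀ i, IsBlockUnion k (Q i)) (n : ℕ)
    (x y : Balaban1983to89.Site P j) :
    (gZero a c (gaugeAct g U) k Q h * rOp a c (gaugeAct g U) k Q h ^ n) x y
      = toC (g x * (g y)⁻¹) * (gZero a c U k Q h * rOp a c U k Q h ^ n) x y := by
  rw [gZero_mul_pow_rOp_gaugeAct Q h g U hk hc ha hQ n, mulOp_sandwich_apply, toC_mul, toC_inv]; ring

end Gauge

/-! ## §6 The norm bookkeeping of (2.12)/(2.13) in the `ℓ^∞`-operator norm: `‖a_i‖ ≤ ‖G_k(Q_i,u)‖`, `‖b_i‖ ≤ ‖K_iG_k(Q_i,u)‖`,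
`‖R‖ ≤ m₀β` when every site lies in at most `m₀` of the `Q_i` -/

section Norms

open scoped Matrix.Norms.Operator NNReal

variable {m n : Type*} [Fintype m] [Fintype n]

/-- kernel: a row sum of moduli is bounded by the `ℓ^∞`-operator norm (`‖A‖ = max_x Σ_y ‖A(x,y)‖`). [folklore] -/
private theorem row_sum_norm_le (A : Matrix m n ℂ) (x : m) : ∑ y, ‖A x y‖ ≤ ‖A‖ := by
  rw [linfty_opNorm_def]
  have h1 : (∑ y, ‖A x y‖₊) ≤ (Finset.univ : Finset m).sup fun i : m => ∑ j : n, ‖A i j‖₊ :=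
    Finset.le_sup (f := fun i : m => ∑ j : n, ‖A i j‖₊) (Finset.mem_univ x)
  have h2 := NNReal.coe_le_coe.2 h1
  push_cast at h2
  exact h2

/-- **THE MULTIPLICITY BOUND**: if every row `x` is a zero row of all but at most `m₀` of the `B_i`, and `‖B_i‖ ≤ β`, then
`‖Σ_i B_i‖ ≤ m₀β` in the `ℓ^∞`-operator norm (the volume-independent bound behind *"R is a small operator in reasonable norms"*; cf. p35's
`B4Eq212SupNeumann.norm_remainder_le` on a `Pi` space). [cite: Balaban1983RegularityDecay, (2.12) p.577] -/
theorem linfty_opNorm_sum_le_of_rows {ι : Type*} [Fintype ι] (B : ι → Matrix m n ℂ) (S : m → Finset ι)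
    (hS : ∀ x i, i ∉ S x → ∀ y, B i x y = 0) {m₀ : ℕ} (hm : ∀ x, (S x).card ≤ m₀) {β : ℝ} (hβ0 : 0 ≤ β) (hβ : ∀ i, ‖B i‖ ≤ β) :
    ‖∑ i, B i‖ ≤ m₀ * β := by
  have hb0 : (0 : ℝ) ≤ m₀ * β := mul_nonneg (Nat.cast_nonneg _) hβ0
  have key : ∀ x, (∑ y, ‖(∑ i, B i) x y‖ : ℝ) ≤ m₀ * β := by
    intro x
    calc ∑ y, ‖(∑ i, B i) x y‖ = ∑ y, ‖∑ i, B i x y‖ := by simp only [Matrix.sum_apply]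
      _ ≤ ∑ y, ∑ i, ‖B i x y‖ := Finset.sum_le_sum fun y _ => norm_sum_le _ _
      _ = ∑ i, ∑ y, ‖B i x y‖ := Finset.sum_comm
      _ = ∑ i ∈ S x, ∑ y, ‖B i x y‖ := by
          refine (Finset.sum_subset (Finset.subset_univ (S x)) fun i _ hi => ?_).symm
          exact Finset.sum_eq_zero fun y _ => by rw [hS x i hi y, norm_zero]
      _ ≤ ∑ i ∈ S x, ‖B i‖ := Finset.sum_le_sum fun i _ => row_sum_norm_le (B i) x
      _ ≤ (S x).card • β := Finset.sum_le_card_nsmul _ _ _ fun i _ => hβ i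
      _ ≤ m₀ * β := by rw [nsmul_eq_mul]; exact mul_le_mul_of_nonneg_right (Nat.cast_le.2 (hm x)) hβ0
  rw [linfty_opNorm_def, ← Real.coe_toNNReal (m₀ * β) hb0]
  refine NNReal.coe_le_coe.2 (Finset.sup_le fun x _ => ?_)
  rw [← NNReal.coe_le_coe, Real.coe_toNNReal _ hb0]
  push_cast
  exact key x

variable {J : Type*} {k : ℕ} {a c : ℝ} {Q : J → Finset (Balaban1983to89.Site P j)} {h : J → Balaban1983to89.Site P j → ℝ}

/-- kernel: `‖h‖ ≤ 1` as an operator when `|h(x)| ≤ 1` ([6]'s cut-offs take values in `[0,1]`). [cite: Balaban1983RegularityDecay, (2.2) p.575] -/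
theorem norm_mulR_le_one {h₁ : Balaban1983to89.Site P j → ℝ} (hh : ∀ x, |h₁ x| ≤ 1) : ‖mulR h₁‖ ≤ 1 := by
  unfold mulR
  rw [linfty_opNorm_diagonal]
  refine (pi_norm_le_iff_of_nonneg zero_le_one).2 fun x => ?_
  rw [Complex.norm_real, Real.norm_eq_abs]
  exact hh x

/-- **`‖a_i‖ ≤ ‖G_k(Q_i,u)‖`** for `|h_i| ≤ 1` — the letter bound `α` of (2.13) is a bound on the cube propagators ([6] Lemma 2.1).
[cite: Balaban1983RegularityDecay, (2.13) p.577] -/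
theorem norm_aLet_le (U : GaugeField P j U1) {i : J} (hh : ∀ x, |h i x| ≤ 1) : ‖aLet a c U k Q h i‖ ≤ ‖gBox a c U k (Q i)‖ := by
  unfold aLet
  calc ‖mulR (h i) * gBox a c U k (Q i) * mulR (h i)‖ ≤ ‖mulR (h i)‖ * ‖gBox a c U k (Q i)‖ * ‖mulR (h i)‖ :=
        (norm_mul_le _ _).trans (mul_le_mul_of_nonneg_right (norm_mul_le _ _) (norm_nonneg _))
    _ ≤ 1 * ‖gBox a c U k (Q i)‖ * 1 :=
        mul_le_mul (mul_le_mul_of_nonneg_right (norm_mulR_le_one hh) (norm_nonneg _)) (norm_mulR_le_one hh) (norm_nonneg _)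
          (mul_nonneg zero_le_one (norm_nonneg _))
    _ = ‖gBox a c U k (Q i)‖ := by rw [one_mul, mul_one]

/-- **`‖b_i‖ ≤ ‖K_iG_k(Q_i,u)‖`** for `|h_i| ≤ 1` — the letter bound `β` of (2.13) is [6]'s *"‖K_jG_k(□_j,Ã_j)h_j‖ ≤ c₂O(1)M^{−1}"*
input. [cite: Balaban1983RegularityDecay, (2.13) p.577] -/
theorem norm_bLet_le (U : GaugeField P j U1) {i : J} (hh : ∀ x, |h i x| ≤ 1) :
    ‖bLet a c U k Q h i‖ ≤ ‖kLet a c U k Q h i * gBox a c U k (Q i)‖ := by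
  unfold bLet
  calc ‖kLet a c U k Q h i * gBox a c U k (Q i) * mulR (h i)‖ ≤ ‖kLet a c U k Q h i * gBox a c U k (Q i)‖ * ‖mulR (h i)‖ := norm_mul_le _ _
    _ ≤ ‖kLet a c U k Q h i * gBox a c U k (Q i)‖ * 1 := mul_le_mul_of_nonneg_left (norm_mulR_le_one hh) (norm_nonneg _)
    _ = ‖kLet a c U k Q h i * gBox a c U k (Q i)‖ := mul_one _

/-- kernel: `H_Q(u)` has zero rows outside `Q`. [cite: BalabanImbrieJaffe1988, (2.27) p.263] -/
theorem nOp_apply_eq_zero_of_not_mem (a c : ℝ) (U : GaugeField P j U1) (k : ℕ) {Q' : Finset (Balaban1983to89.Site P j)}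
    {x : Balaban1983to89.Site P j} (hx : x ∉ Q') (y : Balaban1983to89.Site P j) : nOp a c U k Q' x y = 0 := by
  rw [← proj_mul_nOp]
  unfold proj
  rw [diagonal_mul, if_neg hx, zero_mul]

/-- kernel: the rows of `b_i = K_iG_k(Q_i,u)h_i` outside `Q_i` vanish (`K_i(x,y) = (h_i(x) − h_i(y))H_{Q_i}(x,y)`).
[cite: Balaban1983RegularityDecay, (2.11) p.576] -/
theorem bLet_apply_eq_zero_of_not_mem (U : GaugeField P j U1) {i : J} {x : Balaban1983to89.Site P j} (hx : x ∉ Q i)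
    (y : Balaban1983to89.Site P j) : bLet a c U k Q h i x y = 0 := by
  unfold bLet
  rw [Matrix.mul_assoc, Matrix.mul_apply]
  exact Finset.sum_eq_zero fun z _ => by rw [kLet_apply, nOp_apply_eq_zero_of_not_mem a c U k hx z, mul_zero, zero_mul]

variable [Fintype J]

/-- **`‖R‖ ≤ m₀β`** in the `ℓ^∞`-operator norm when every site of the torus lies in at most `m₀` of the regions `Q_i` and `‖b_i‖ ≤ β`
(for [6]'s cubes `□_j`, `m₀ ≤ 2^d`): the smallness of `R` is the smallness of the single letters, uniformly in the volume.
[cite: Balaban1983RegularityDecay, (2.12) p.577] -/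
theorem norm_rOp_le (U : GaugeField P j U1) {m₀ : ℕ} (hm : ∀ x, (Finset.univ.filter fun i => x ∈ Q i).card ≤ m₀) {β : ℝ}
    (hβ0 : 0 ≤ β) (hβ : ∀ i, ‖bLet a c U k Q h i‖ ≤ β) : ‖rOp a c U k Q h‖ ≤ m₀ * β := by
  unfold rOp
  refine linfty_opNorm_sum_le_of_rows _ (fun x => Finset.univ.filter fun i => x ∈ Q i) (fun x i hi y => ?_) hm hβ0 hβ
  have hx : x ∉ Q i := fun hxQ => hi (Finset.mem_filter.2 ⟨Finset.mem_univ i, hxQ⟩)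
  exact bLet_apply_eq_zero_of_not_mem U hx y

variable [DecidableEq J] {Ω : Finset (Balaban1983to89.Site P j)}

/-- **(2.13) FROM THE PRINTED INPUTS**: the random walk representation of `G_k(Ω,u)` given a localization datum with cut-offs
`|h_i| ≤ 1`, every site in at most `m₀` regions `Q_i`, a label adjacency of degree `≤ D` off which the letters annihilate, and the two
analytic inputs of p. 577 — `‖G_k(Q_i,u)‖ ≤ α` (Lemma 2.1) and `‖K_iG_k(Q_i,u)‖ ≤ β` with `m₀β < 1`, `Dβ < 1`.
[cite: Balaban1983RegularityDecay, (2.13) p.577] -/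
theorem hasSum_piece_of_inputs (D' : IsLocalization k Ω Q h) (hk : j + k ≤ P.m + P.K) (hc : c ≠ 0) (ha : 0 < a) (U : GaugeField P j U1)
    (hΩ : IsBlockUnion k Ω) (hh : ∀ i x, |h i x| ≤ 1) (adj : J → J → Prop) [DecidableRel adj] {α β : ℝ} {Dn m₀ : ℕ}
    (hab : ∀ i l, ¬ adj i l → aLet a c U k Q h i * bLet a c U k Q h l = 0)
    (hbb : ∀ i l, ¬ adj i l → bLet a c U k Q h i * bLet a c U k Q h l = 0)
    (hD : ∀ l, (Finset.univ.filter fun i => adj l i).card ≤ Dn) (hm : ∀ x, (Finset.univ.filter fun i => x ∈ Q i).card ≤ m₀)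
    (hα : ∀ i, ‖gBox a c U k (Q i)‖ ≤ α) (hβ0 : 0 ≤ β) (hβ : ∀ i, ‖kLet a c U k Q h i * gBox a c U k (Q i)‖ ≤ β)
    (hDβ : (Dn : ℝ) * β < 1) (hmβ : (m₀ : ℝ) * β < 1) :
    HasSum (piece a c U k Q h) (gBox a c U k Ω) :=
  hasSum_piece D' hk hc ha U hΩ adj hab hbb (fun i => (norm_aLet_le U (hh i)).trans (hα i))
    (fun i => (norm_bLet_le U (hh i)).trans (hβ i)) hD hDβ ((norm_rOp_le U hm hβ0 fun i => (norm_bLet_le U (hh i)).trans (hβ i)).trans_lt hmβ)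

end Norms

end

end Literature.MathematicalPhysics.QuantumFieldTheory.BalabanImbrieJaffe1984to88.BIJ88NeumannRandomWalkTorus
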